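import Literature.Probability.RandomPlanarGeometry.HexSAWBrickWallStripFugacityTwoSided
import Literature.Probability.RandomPlanarGeometry.HexSAWSurfaceWallBridges
import HarnessLib

/-!
# BBdGDCG14 Proposition 6, first clause: arches, bridges and walks of the strip `S_T` have the same growth rate `μ_T(y,z)`

Topic `Literature/Probability/RandomPlanarGeometry` (continues `HexSAWBrickWallStripFugacityTwoSided.lean` — the
two-surface partition function `C_{T,n}(y,z) = HexBW.stripZ₂ T n y z` of the brick-wall strip `S_T = ℤ × {0,…,T}`
with a fugacity `y` per bottom-surface (level-`0`) vertex and `z` per top-surface vertex, and its growth rate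
`μ_T(y,z) = HexBW.stripMuY₂ T y z`, `tendsto_stripZ₂_rpow`).

Source.  N. R. Beaton, M. Bousquet-Mélou, J. de Gier, H. Duminil-Copin, A. J. Guttmann, *The critical fugacity for
surface adsorption of self-avoiding walks on the honeycomb lattice is `1+√2`*, Comm. Math. Phys. 326 (2014),
arXiv:1109.0358v5, §3.2, Proposition 6 (p. 10): "For `y, z > 0`, one has
`lim_{k→∞} a_{T,k}(y,z)^{1/k} = lim_{k→∞} b_{T,k}(y,z)^{1/k} = lim_{k→∞} c_{T,k}(y,z)^{1/k} := μ_T(y,z)`" — here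
`a_{T,k} = archZ₂ T k`, `b_{T,k} = bridgeZ₂ T k`, `c_{T,k} = stripZ₂ T k` are the partition functions of ARCHES (walks from
the bottom surface back to the bottom surface: "arches if they end at the bottom of the strip"), of BRIDGES ("and bridges
if they end at the top", p. 10) and of all strip walks; printed proof (p. 11): "the existence of the limits follows
from concatenation and unfolding arguments as given in Section 4 of [16]" ([16] = Janse van Rensburg–Orlandini–Whittington
2006).  The lane's tree had the `C`-limit
(`tendsto_stripZ₂_rpow`) only; this file supplies the arch and bridge limits, by UNFOLDING INSIDE THE STRIP: the
tree's transpose-free two-sided unfolding `HexBW.Wall.G` of `HexSAWSurfaceWallBridges.lean` keeps every second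
coordinate and every abscissa parity, hence keeps a strip walk in the strip with the same bottom/top surface
visits, and is at most `e^{6√n}`-to-one (`Wall.card_le_exp_mul_card_image_G`); an unfolded walk (abscissa weakly
minimal at the start, maximal at the end) is then completed into an arch or a bridge of length `n + 4T + 6` by two
staircases of the brick wall attached strictly to the left of its start and strictly to the right of its end.

Edition 2 (a-p5 gen 13): lit-1 g18 tokens AR-1/AR-2/AR-3 folded (08:18:15Z) — docstrings only, code verbatim.

## Contents (namespace `Literature.Probability.RandomPlanarGeometry.SAW.HexBW`, all PROVED, standard axioms)

* §1 `IsBotV`, `IsTopV T` — bottom-surface (row `0`, odd abscissa) / top-surface (row `T`, `x + T` even) vertices;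
  `archPairs T n`, `bridgePairs T n` (⊆ `stripPairs T n`), `archZ₂ T n y z = A_{T,n}(y,z)`,
  `bridgeZ₂ T n y z = B_{T,n}(y,z)`; `archZ₂_le_stripZ₂`, `bridgeZ₂_le_stripZ₂`.
* §2 `unfPairs T n`, `unfZ₂` (unfolded strip walks), `twist_mem_saws`, `twistG`, `twistG_apply_one`,
  `twistG_apply_zero_mod_two`, **`twistG_spec`** (the strip unfolding keeps the strip and both surface-visit counts),
  `card_le_exp_mul_card_image_twistG`, **`stripZ₂_le_exp_mul_unfZ₂`** — `C_{T,n}(y,z) ≤ e^{6√n} U_{T,n}(y,z)` (`n` even).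
* §3 staircases of the brick wall: `stairV`, `stair p H σ L` (coordinates, `stair_mem_zd_saws`, `stair_adj_add` — the
  placed staircase uses brick-wall bonds when the base has the right parity, `stair_apply_zero_le_sub_one`, `stair_apply_end`).
* §4 the completions: `par`, `preLen`, `sufLenA`, `sufLenB`, `prePiece`, `sufPieceA`, `sufPieceB`, `botStart = (1,0)`,
  `toArch`, `toBridge`, `cmpl`, `shiftV` (an even horizontal shift), **`cmpl_spec`** (any admissible appended piece gives a
  strip walk from `(1,0)` whose surface visits exceed those of the walk by at most the added length),
  **`toArch_spec`** / **`toBridge_spec`** (arch of length `m + 4T + 6` / bridge of length `m + 4T + 7`),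
  `toArch_injOn` / `toBridge_injOn` (injective on each start fibre).
* §5 `pow_le_yK_pow_mul`, `sum_fibre_le_of_injOn`, `unfZ₂_le_of_injOn`, **`unfZ₂_le_archZ₂`**, **`unfZ₂_le_bridgeZ₂`** —
  `U_{T,m} ≤ 2(T+1)·(max(1,y⁻¹)max(1,z⁻¹))^{4T+6}·A_{T,m+4T+6}` (resp. `4T+7`, bridges); `stripMuY₂_pow_le`
  (`μ_T(y,z)^m ≤ max(1,y⁻¹)max(1,z⁻¹) C_{T,m}`), `tendsto_rpow_of_squeeze`, `stripMuY₂_pow_le_archZ₂` / `_bridgeZ₂`, and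
  ★ **`tendsto_archZ₂_rpow`** — `A_{T,2j}(y,z)^{1/(2j)} → μ_T(y,z)`, ★ **`tendsto_bridgeZ₂_rpow`** —
  `B_{T,2j+1}(y,z)^{1/(2j+1)} → μ_T(y,z)` (`y, z > 0`, every `T`; arches have even and bridges odd length in this
  embedding), with the printed one-surface forms `tendsto_archZ₂_rpow_one`, `tendsto_bridgeZ₂_rpow_one`
  (`→ μ_T(y,1) = HexBW.stripMuY₀ T y`).

Label (lane «pcv-sawmu»): CONSOLIDATION AT KERNEL RIGOUR of BBdGDCG14 Proposition 6, first display (existence and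
equality of the arch / bridge / walk limits), printed with proof by reference (p. 11: "as given in Section 4 of [16]");
the honeycomb proof written here (unfold inside the strip with the tree's transpose-free `G`, complete by staircases)
is the lane's.  Not claimed: the arch/bridge SERIES statements of Corollary 8 (radius of convergence in `x` and in `y`),
which follow from these limits and are left to a sequel.
-/

noncomputable section

open Filter Topology Finset Literature.Probability.LatticeModels Literature.Probability.Percolation SimpleGraph

namespace Literature.Probability.RandomPlanarGeometry.SAW.HexBW

variable {T n : ℕ} {y z : ℝ}

/-! ### Surface vertices, arches and bridges of the strip -/

/-- A bottom-surface (level-`0`) vertex of the strip: row `0`, odd abscissa (the vertices of `S_T` carrying a dangling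
half-edge below the strip). [cite: BeatonBousquetMelouDeGierDuminilCopinGuttmann2014, §3.2 (arXiv v5 p. 10: contacts with the bottom of the strip)] -/
def IsBotV (v : Site 2) : Prop := v 1 = 0 ∧ v 0 % 2 = 1

/-- A top-surface vertex of `S_T`: row `T`, `x + T` even (a dangling half-edge above the strip).
[cite: BeatonBousquetMelouDeGierDuminilCopinGuttmann2014, §3.2 (arXiv v5 p. 10: contacts with the top of the strip)] -/
def IsTopV (T : ℕ) (v : Site 2) : Prop := v 1 = (T : ℤ) ∧ (v 0 + T) % 2 = 0

/-- Being a bottom-surface vertex is decidable. [cite: BeatonBousquetMelouDeGierDuminilCopinGuttmann2014, §3.2 (arXiv v5 p. 10)] -/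
instance instDecidableIsBotV (v : Site 2) : Decidable (IsBotV v) := by unfold IsBotV; infer_instance

/-- Being a top-surface vertex is decidable. [cite: BeatonBousquetMelouDeGierDuminilCopinGuttmann2014, §3.2 (arXiv v5 p. 10)] -/
instance instDecidableIsTopV (T : ℕ) (v : Site 2) : Decidable (IsTopV T v) := by unfold IsTopV; infer_instance

/-- **Arches** of `S_T` of length `n`: strip walks from a bottom-surface vertex to a bottom-surface vertex (pairs
`(a, υ)` of `stripPairs T n`). [cite: BeatonBousquetMelouDeGierDuminilCopinGuttmann2014, §3.2 (arXiv v5 p. 10: "Such walks are said to be arches if they end at the bottom of the strip")] -/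
def archPairs (T n : ℕ) : Finset (Site 2 × (ℕ → Site 2)) :=
  (stripPairs T n).filter fun p => IsBotV p.1 ∧ IsBotV (p.1 + p.2 n)

/-- **Bridges** of `S_T` of length `n`: strip walks from a bottom-surface vertex to a top-surface vertex.
[cite: BeatonBousquetMelouDeGierDuminilCopinGuttmann2014, §3.2 (arXiv v5 p. 10: "and bridges if they end at the top")] -/
def bridgePairs (T n : ℕ) : Finset (Site 2 × (ℕ → Site 2)) :=
  (stripPairs T n).filter fun p => IsBotV p.1 ∧ IsTopV T (p.1 + p.2 n)

/-- **`A_{T,n}(y,z)`**, the two-surface partition function of arches. [cite: BeatonBousquetMelouDeGierDuminilCopinGuttmann2014, §3.2 (arXiv v5 p. 10: the printed a_{T,k}(y,z))] -/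
def archZ₂ (T n : ℕ) (y z : ℝ) : ℝ :=
  ∑ p ∈ archPairs T n, y ^ bottomVisits₀ p.1 p.2 n * z ^ topVisits₀ T p.1 p.2 n

/-- **`B_{T,n}(y,z)`**, the two-surface partition function of bridges. [cite: BeatonBousquetMelouDeGierDuminilCopinGuttmann2014, §3.2 (arXiv v5 p. 10: the printed b_{T,k}(y,z))] -/
def bridgeZ₂ (T n : ℕ) (y z : ℝ) : ℝ :=
  ∑ p ∈ bridgePairs T n, y ^ bottomVisits₀ p.1 p.2 n * z ^ topVisits₀ T p.1 p.2 n

/-- `archPairs ⊆ stripPairs`. [cite: BeatonBousquetMelouDeGierDuminilCopinGuttmann2014, §3.2 (arXiv v5 p. 10)] -/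
theorem archPairs_subset (T n : ℕ) : archPairs T n ⊆ stripPairs T n := Finset.filter_subset _ _

/-- `bridgePairs ⊆ stripPairs`. [cite: BeatonBousquetMelouDeGierDuminilCopinGuttmann2014, §3.2 (arXiv v5 p. 10)] -/
theorem bridgePairs_subset (T n : ℕ) : bridgePairs T n ⊆ stripPairs T n := Finset.filter_subset _ _

/-- Membership in `archPairs`. [cite: BeatonBousquetMelouDeGierDuminilCopinGuttmann2014, §3.2 (arXiv v5 p. 10)] -/
theorem mem_archPairs {p : Site 2 × (ℕ → Site 2)} :
    p ∈ archPairs T n ↔ p ∈ stripPairs T n ∧ IsBotV p.1 ∧ IsBotV (p.1 + p.2 n) := by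
  rw [archPairs, Finset.mem_filter]

/-- Membership in `bridgePairs`. [cite: BeatonBousquetMelouDeGierDuminilCopinGuttmann2014, §3.2 (arXiv v5 p. 10)] -/
theorem mem_bridgePairs {p : Site 2 × (ℕ → Site 2)} :
    p ∈ bridgePairs T n ↔ p ∈ stripPairs T n ∧ IsBotV p.1 ∧ IsTopV T (p.1 + p.2 n) := by
  rw [bridgePairs, Finset.mem_filter]

/-- `0 ≤ A_{T,n}(y,z)`. [cite: BeatonBousquetMelouDeGierDuminilCopinGuttmann2014, §3.2 (arXiv v5 p. 10)] -/
theorem archZ₂_nonneg (T n : ℕ) (hy : 0 ≤ y) (hz : 0 ≤ z) : 0 ≤ archZ₂ T n y z :=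
  Finset.sum_nonneg fun _ _ => mul_nonneg (pow_nonneg hy _) (pow_nonneg hz _)

/-- `0 ≤ B_{T,n}(y,z)`. [cite: BeatonBousquetMelouDeGierDuminilCopinGuttmann2014, §3.2 (arXiv v5 p. 10)] -/
theorem bridgeZ₂_nonneg (T n : ℕ) (hy : 0 ≤ y) (hz : 0 ≤ z) : 0 ≤ bridgeZ₂ T n y z :=
  Finset.sum_nonneg fun _ _ => mul_nonneg (pow_nonneg hy _) (pow_nonneg hz _)

/-- `A_{T,n}(y,z) ≤ C_{T,n}(y,z)`. [cite: BeatonBousquetMelouDeGierDuminilCopinGuttmann2014, Proposition 6 (arXiv v5 p. 10)] -/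
theorem archZ₂_le_stripZ₂ (T n : ℕ) (hy : 0 ≤ y) (hz : 0 ≤ z) : archZ₂ T n y z ≤ stripZ₂ T n y z :=
  Finset.sum_le_sum_of_subset_of_nonneg (archPairs_subset T n) fun _ _ _ =>
    mul_nonneg (pow_nonneg hy _) (pow_nonneg hz _)

/-- `B_{T,n}(y,z) ≤ C_{T,n}(y,z)`. [cite: BeatonBousquetMelouDeGierDuminilCopinGuttmann2014, Proposition 6 (arXiv v5 p. 10)] -/
theorem bridgeZ₂_le_stripZ₂ (T n : ℕ) (hy : 0 ≤ y) (hz : 0 ≤ z) : bridgeZ₂ T n y z ≤ stripZ₂ T n y z :=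
  Finset.sum_le_sum_of_subset_of_nonneg (bridgePairs_subset T n) fun _ _ _ =>
    mul_nonneg (pow_nonneg hy _) (pow_nonneg hz _)

/-! ### Unfolding inside the strip -/

/-- The UNFOLDED strip walks: `(a, υ) ∈ stripPairs T n` with the abscissa weakly minimal at the start and weakly
maximal at the end (`HexBW.Wall.IsWB`). [cite: HammersleyTorrieWhittington1982, §2 (unfolded walks); BeatonBousquetMelouDeGierDuminilCopinGuttmann2014, Proposition 6 (arXiv v5 p. 10; proof p. 11: "concatenation and unfolding arguments as given in Section 4 of [16]")] -/
def unfPairs (T n : ℕ) : Finset (Site 2 × (ℕ → Site 2)) :=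
  (stripPairs T n).filter fun p => ∀ i ≤ n, p.2 0 0 ≤ p.2 i 0 ∧ p.2 i 0 ≤ p.2 n 0

/-- **`U_{T,n}(y,z)`**, the two-surface partition function of unfolded strip walks. [cite: BeatonBousquetMelouDeGierDuminilCopinGuttmann2014, Proposition 6 (arXiv v5 p. 10)] -/
def unfZ₂ (T n : ℕ) (y z : ℝ) : ℝ :=
  ∑ p ∈ unfPairs T n, y ^ bottomVisits₀ p.1 p.2 n * z ^ topVisits₀ T p.1 p.2 n

/-- Membership in `unfPairs`. [cite: BeatonBousquetMelouDeGierDuminilCopinGuttmann2014, Proposition 6 (arXiv v5 p. 10)] -/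
theorem mem_unfPairs {p : Site 2 × (ℕ → Site 2)} :
    p ∈ unfPairs T n ↔ p ∈ stripPairs T n ∧ Wall.IsWB n p.2 := by
  rw [unfPairs, Finset.mem_filter]; rfl

/-- `0 ≤ U_{T,n}(y,z)`. [cite: BeatonBousquetMelouDeGierDuminilCopinGuttmann2014, Proposition 6 (arXiv v5 p. 10)] -/
theorem unfZ₂_nonneg (T n : ℕ) (hy : 0 ≤ y) (hz : 0 ≤ z) : 0 ≤ unfZ₂ T n y z :=
  Finset.sum_nonneg fun _ _ => mul_nonneg (pow_nonneg hy _) (pow_nonneg hz _)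

/-- Reading the translate `υ` of a walk placed at `a` through the parity twist of `a` gives a brick-wall walk from the
origin: `(a, υ) ∈ stripPairs T n → (i ↦ twistAt a (υ i)) ∈ saws n`. [cite: EntingJensen2009, §7.4.2, Fig. 7.10 (brickwork form of the honeycomb lattice)] -/
theorem twist_mem_saws {p : Site 2 × (ℕ → Site 2)} (hp : p ∈ stripPairs T n) :
    (fun i => twistAt p.1 (p.2 i)) ∈ saws n := by
  obtain ⟨-, hυ, hbw, -⟩ := mem_stripPairs.1 hp
  refine mem_saws.2 ⟨twistAt_comp_mem_zdSaws p.1 hυ, fun i hi => ?_⟩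
  have h : brickWallGraph.Adj (p.1 + p.2 i) (p.1 + p.2 (i + 1)) := hbw i hi
  rw [← twistAt_twistAt p.1 (p.2 i), ← twistAt_twistAt p.1 (p.2 (i + 1)), adj_add_twistAt_iff] at h
  exact h

/-- **The strip unfolding** of a placed walk `(a, υ)`: the tree's two-sided unfolding `Wall.G`, conjugated by the parity
twist of `a`. [cite: MadrasSlade1993, §3.1 (proof of Theorem 3.1.1: unfolding both ends); HammersleyTorrieWhittington1982, §2] -/
def twistG (n : ℕ) (p : Site 2 × (ℕ → Site 2)) : Site 2 × (ℕ → Site 2) :=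
  (p.1, fun i => twistAt p.1 (Wall.G n (fun j => twistAt p.1 (p.2 j)) i))

/-- The strip unfolding keeps every second coordinate. [cite: MadrasSlade1993, §3.1 (proof of Proposition 3.1.5)] -/
theorem twistG_apply_one {p : Site 2 × (ℕ → Site 2)} (hp : p ∈ stripPairs T n) (hn : n % 2 = 0) {i : ℕ}
    (hi : i ≤ n) : (twistG n p).2 i 1 = p.2 i 1 := by
  have hY := (Wall.G_spec (twist_mem_saws hp) hn).2.2 i hi
  dsimp only [twistG]
  unfold twistAt at *
  split_ifs at hY ⊢ with h
  · exact hY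
  · rw [negY_apply_one, hY, negY_apply_one, neg_neg]

/-- The strip unfolding keeps every abscissa parity. [cite: EntingJensen2009, §7.4.2, Fig. 7.10 (brickwork form of the honeycomb lattice: the parity of x + y alternates along a walk)] -/
theorem twistG_apply_zero_mod_two {p : Site 2 × (ℕ → Site 2)} (hp : p ∈ stripPairs T n) (hn : n % 2 = 0) {i : ℕ}
    (hi : i ≤ n) : (twistG n p).2 i 0 % 2 = p.2 i 0 % 2 := by
  have hs := twist_mem_saws hp
  obtain ⟨hG, -, hY⟩ := Wall.G_spec hs hn
  have h1 := parity_apply hG hi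
  have h2 := parity_apply hs hi
  have hYi := hY i hi
  simp only [twistG, twistAt_apply_zero] at *
  omega

/-- **`twistG` maps `stripPairs T n` into `unfPairs T n` and keeps both surface-visit counts** (`n` even).
[cite: BeatonBousquetMelouDeGierDuminilCopinGuttmann2014, Proposition 6 (arXiv v5 p. 10; proof p. 11: "concatenation and unfolding arguments as given in Section 4 of [16]"); MadrasSlade1993, §3.1] -/
theorem twistG_spec {p : Site 2 × (ℕ → Site 2)} (hp : p ∈ stripPairs T n) (hn : n % 2 = 0) :
    twistG n p ∈ unfPairs T n ∧
      bottomVisits₀ (twistG n p).1 (twistG n p).2 n = bottomVisits₀ p.1 p.2 n ∧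
      topVisits₀ T (twistG n p).1 (twistG n p).2 n = topVisits₀ T p.1 p.2 n := by
  have hs := twist_mem_saws hp
  obtain ⟨hG, hwb, -⟩ := Wall.G_spec hs hn
  obtain ⟨ha, -, -, hstrip⟩ := mem_stripPairs.1 hp
  obtain ⟨hGzd, hGbw⟩ := mem_saws.1 hG
  have hY : ∀ i ≤ n, (twistG n p).2 i 1 = p.2 i 1 := fun i hi => twistG_apply_one hp hn hi
  have hX : ∀ i ≤ n, (twistG n p).2 i 0 % 2 = p.2 i 0 % 2 := fun i hi => twistG_apply_zero_mod_two hp hn hi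
  have h1 : (twistG n p).1 = p.1 := rfl
  refine ⟨mem_unfPairs.2 ⟨mem_stripPairs.2 ⟨ha, ?_, fun i hi => ?_, fun m hm => ?_⟩, fun i hi => ?_⟩, ?_, ?_⟩
  · -- a `Zd` walk: twist of a `Zd` walk
    exact twistAt_comp_mem_zdSaws p.1 hGzd
  · -- brick-wall bonds of the placed walk
    have h := hGbw i hi
    rw [← adj_add_twistAt_iff p.1] at h
    exact h
  · -- stays in the strip: same second coordinates
    have h := hstrip m hm
    simp only [InStrip, Pi.add_apply] at h ⊢
    rw [h1, hY m hm]
    exact h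
  · -- unfolded: `twistAt` keeps abscissae
    have h := hwb i hi
    simp only [twistG, twistAt_apply_zero] at h ⊢
    exact h
  · -- bottom visits: pointwise the same indicator
    unfold bottomVisits₀
    refine Finset.sum_congr rfl fun m hm => ?_
    have hm' : m ≤ n := Nat.lt_succ_iff.1 (Finset.mem_range.1 hm)
    have e1 := hY m hm'
    have e0 := hX m hm'
    simp only [Pi.add_apply, h1] at e1 e0 ⊢
    rw [e1]
    have : (p.1 0 + (twistG n p).2 m 0) % 2 = (p.1 0 + p.2 m 0) % 2 := by omega
    simp only [this]
  · unfold topVisits₀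
    refine Finset.sum_congr rfl fun m hm => ?_
    have hm' : m ≤ n := Nat.lt_succ_iff.1 (Finset.mem_range.1 hm)
    have e1 := hY m hm'
    have e0 := hX m hm'
    simp only [Pi.add_apply, h1] at e1 e0 ⊢
    rw [e1]
    have : (p.1 0 + (twistG n p).2 m 0 + T) % 2 = (p.1 0 + p.2 m 0 + T) % 2 := by omega
    simp only [this]

open Classical in
/-- `twistG` is injective on the pairs with a given starting site, up to the two unfolding codes: on the fibre
`{p ∈ stripPairs T n | p.1 = a}` the map `p ↦ twistAt a ∘ p.2` is injective into `saws n`, where `Wall.G` is at most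
`e^{6√n}`-to-one. Here: the resulting CARDINALITY bound for any set of strip pairs with a common start.
[cite: MadrasSlade1993, §3.1, (3.1.4)–(3.1.5) and Theorem 3.1.1; HammersleyTorrieWhittington1982, §2] -/
theorem card_le_exp_mul_card_image_twistG {S : Finset (Site 2 × (ℕ → Site 2))} (hS : S ⊆ stripPairs T n)
    {a : Site 2} (ha : ∀ p ∈ S, p.1 = a) (hn : n % 2 = 0) :
    (#S : ℝ) ≤ Real.exp (6 * Real.sqrt n) * #(S.image (twistG n)) := by
  classical
  -- the walks read from `a`
  set tw : (ℕ → Site 2) → (ℕ → Site 2) := fun υ i => twistAt a (υ i) with htw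
  have htw_inj : Function.Injective tw := by
    intro υ υ' h
    funext i
    exact twistAt_injective a (congrFun h i)
  set W : Finset (ℕ → Site 2) := S.image fun p => tw p.2 with hW
  have hWs : W ⊆ saws n := by
    intro ω hω
    obtain ⟨p, hp, rfl⟩ := Finset.mem_image.1 hω
    have := twist_mem_saws (hS hp)
    rw [ha p hp] at this
    exact this
  -- `p ↦ tw p.2` is injective on `S` (common first component)
  have hcardW : #W = #S := by
    refine Finset.card_image_of_injOn fun p hp q hq h => ?_
    have h2 : p.2 = q.2 := htw_inj h
    exact Prod.ext (by rw [ha p hp, ha q hq]) h2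
  -- the image of `W` under `G` embeds into the image of `S` under `twistG`
  have himg : (W.image (Wall.G n)).image (fun ω => (a, tw ω)) ⊆ S.image (twistG n) := by
    intro q hq
    obtain ⟨ω, hω, rfl⟩ := Finset.mem_image.1 hq
    obtain ⟨ω', hω', rfl⟩ := Finset.mem_image.1 hω
    obtain ⟨p, hp, rfl⟩ := Finset.mem_image.1 hω'
    refine Finset.mem_image.2 ⟨p, hp, ?_⟩
    rw [twistG, ha p hp]
  have hcard2 : #((W.image (Wall.G n)).image (fun ω => (a, tw ω))) = #(W.image (Wall.G n)) :=
    Finset.card_image_of_injective _ fun ω ω' h => htw_inj (Prod.mk.inj h).2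
  have h1 := Wall.card_le_exp_mul_card_image_G hWs hn
  rw [hcardW] at h1
  refine h1.trans (mul_le_mul_of_nonneg_left ?_ (Real.exp_nonneg _))
  rw [← hcard2]
  exact_mod_cast Finset.card_le_card himg

/-- **`C_{T,n}(y,z) ≤ e^{6√n} · U_{T,n}(y,z)`** for even `n` and `y, z ≥ 0`: fibrewise in (start, bottom visits, top
visits), the strip unfolding is at most `e^{6√n}`-to-one into the unfolded walks of the same fibre.
[cite: BeatonBousquetMelouDeGierDuminilCopinGuttmann2014, Proposition 6 (arXiv v5 p. 10; proof p. 11: "concatenation and unfolding arguments as given in Section 4 of [16]"); MadrasSlade1993, §3.1, Theorem 3.1.1] -/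
theorem stripZ₂_le_exp_mul_unfZ₂ (T : ℕ) (hn : n % 2 = 0) (hy : 0 ≤ y) (hz : 0 ≤ z) :
    stripZ₂ T n y z ≤ Real.exp (6 * Real.sqrt n) * unfZ₂ T n y z := by
  classical
  -- fibre key: (start, bottom visits, top visits)
  set κ : Site 2 × (ℕ → Site 2) → Site 2 × ℕ × ℕ :=
    fun p => (p.1, bottomVisits₀ p.1 p.2 n, topVisits₀ T p.1 p.2 n) with hκ
  set K : Finset (Site 2 × ℕ × ℕ) := stripStarts T ×ˢ (range (n + 2) ×ˢ range (n + 2)) with hK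
  have hmaps : ∀ p ∈ stripPairs T n, κ p ∈ K := fun p hp =>
    Finset.mem_product.2 ⟨(mem_stripPairs.1 hp).1, Finset.mem_product.2
      ⟨Finset.mem_range.2 (Nat.lt_succ_of_le (bottomVisits₀_le _ _ _)),
        Finset.mem_range.2 (Nat.lt_succ_of_le (topVisits₀_le _ _ _ _))⟩⟩
  have hmapsU : ∀ p ∈ unfPairs T n, κ p ∈ K := fun p hp => hmaps p (mem_unfPairs.1 hp).1
  rw [stripZ₂, unfZ₂, ← Finset.sum_fiberwise_of_maps_to hmaps, ← Finset.sum_fiberwise_of_maps_to hmapsU,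
    Finset.mul_sum]
  refine Finset.sum_le_sum fun c _ => ?_
  set FA := (stripPairs T n).filter (fun p => κ p = c)
  set FU := (unfPairs T n).filter (fun p => κ p = c)
  have hwt : ∀ p : Site 2 × (ℕ → Site 2), κ p = c →
      y ^ bottomVisits₀ p.1 p.2 n * z ^ topVisits₀ T p.1 p.2 n = y ^ c.2.1 * z ^ c.2.2 := by
    rintro p rfl
    rfl
  have hA : ∑ p ∈ FA, y ^ bottomVisits₀ p.1 p.2 n * z ^ topVisits₀ T p.1 p.2 n = #FA * (y ^ c.2.1 * z ^ c.2.2) := by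
    rw [Finset.sum_congr rfl fun p hp => hwt p (Finset.mem_filter.1 hp).2, Finset.sum_const, nsmul_eq_mul]
  have hU : ∑ p ∈ FU, y ^ bottomVisits₀ p.1 p.2 n * z ^ topVisits₀ T p.1 p.2 n = #FU * (y ^ c.2.1 * z ^ c.2.2) := by
    rw [Finset.sum_congr rfl fun p hp => hwt p (Finset.mem_filter.1 hp).2, Finset.sum_const, nsmul_eq_mul]
  rw [hA, hU]
  have hS : FA ⊆ stripPairs T n := Finset.filter_subset _ _
  have ha : ∀ p ∈ FA, p.1 = c.1 := fun p hp => by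
    have e : κ p = c := (Finset.mem_filter.1 hp).2
    rw [← e]
  have himg : FA.image (twistG n) ⊆ FU := by
    intro q hq
    obtain ⟨p, hp, rfl⟩ := Finset.mem_image.1 hq
    obtain ⟨hps, e⟩ := Finset.mem_filter.1 hp
    obtain ⟨h1, h2, h3⟩ := twistG_spec hps hn
    refine Finset.mem_filter.2 ⟨h1, ?_⟩
    rw [← e]
    change ((twistG n p).1, _, _) = (p.1, _, _)
    rw [h2, h3]
    rfl
  have h1 := card_le_exp_mul_card_image_twistG hS ha hn
  have h2 : (#(FA.image (twistG n)) : ℝ) ≤ #FU := by exact_mod_cast Finset.card_le_card himg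
  have hw : 0 ≤ y ^ c.2.1 * z ^ c.2.2 := mul_nonneg (pow_nonneg hy _) (pow_nonneg hz _)
  calc (#FA : ℝ) * (y ^ c.2.1 * z ^ c.2.2) ≤ (Real.exp (6 * Real.sqrt n) * #FU) * (y ^ c.2.1 * z ^ c.2.2) := by
        refine mul_le_mul_of_nonneg_right (h1.trans ?_) hw
        exact mul_le_mul_of_nonneg_left h2 (Real.exp_nonneg _)
    _ = Real.exp (6 * Real.sqrt n) * (#FU * (y ^ c.2.1 * z ^ c.2.2)) := by ring

/-! ### Staircases of the brick wall -/

/-- Coordinate form of `ℤ²`-adjacency (re-derived here to keep the imports small). [cite: MadrasSlade1993, §1.1] -/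
private theorem zd_adj_coord (x y : Site 2) :
    (zdGraph 2).Adj x y ↔
      ((y 0 = x 0 + 1 ∨ x 0 = y 0 + 1) ∧ y 1 = x 1) ∨ ((y 1 = x 1 + 1 ∨ x 1 = y 1 + 1) ∧ y 0 = x 0) := by
  rw [zdGraph_adj_iff, Fin.exists_fin_two]
  simp only [funext_iff, Fin.forall_fin_two, Pi.add_apply, Pi.single_eq_same,
    Pi.single_eq_of_ne (one_ne_zero : (1 : Fin 2) ≠ 0),
    Pi.single_eq_of_ne (zero_ne_one : (0 : Fin 2) ≠ 1), add_zero]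
  omega

/-- Two sites of `ℤ²` with equal coordinates are equal. [cite: MadrasSlade1993, §1.1] -/
private theorem site_ext₂ {x z : Site 2} (h0 : x 0 = z 0) (h1 : x 1 = z 1) : x = z :=
  funext fun j => (Fin.forall_fin_two (p := fun j => x j = z j)).2 ⟨h0, h1⟩ j

/-- The number of VERTICAL steps among the first `i` steps of the staircase with pattern parameter `p ∈ {0,1}` and at most
`H` vertical steps: `min ((i − p)/2) H` (the vertical steps are the steps number `p + 2, p + 4, …, p + 2H`).
[cite: EntingJensen2009, §7.4.2, Fig. 7.10 (brickwork form of the honeycomb lattice)] -/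
def stairV (p H i : ℕ) : ℕ := min ((i - p) / 2) H

/-- **The staircase** read from the origin and frozen after `L` steps: horizontal steps `+e₀` interleaved with `H`
vertical steps `σ e₁` (`σ = ±1`), then horizontal steps only; after `i ≤ L` steps it sits at
`(i − stairV p H i, σ · stairV p H i)`. [cite: EntingJensen2009, §7.4.2, Fig. 7.10 (brickwork form of the honeycomb lattice); BeatonBousquetMelouDeGierDuminilCopinGuttmann2014, §3.1 (arXiv v5 p. 9: zig-zag walks along the surface)] -/
def stair (p H : ℕ) (σ : ℤ) (L : ℕ) (i : ℕ) : Site 2 :=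
  ![((min i L : ℕ) : ℤ) - (stairV p H (min i L) : ℕ), σ * (stairV p H (min i L) : ℕ)]

/-- First coordinate of the staircase. [cite: EntingJensen2009, §7.4.2, Fig. 7.10] -/
theorem stair_apply_zero (p H : ℕ) (σ : ℤ) (L i : ℕ) :
    stair p H σ L i 0 = ((min i L : ℕ) : ℤ) - (stairV p H (min i L) : ℕ) := rfl

/-- Second coordinate of the staircase. [cite: EntingJensen2009, §7.4.2, Fig. 7.10] -/
theorem stair_apply_one (p H : ℕ) (σ : ℤ) (L i : ℕ) :
    stair p H σ L i 1 = σ * (stairV p H (min i L) : ℕ) := rfl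

/-- `stairV p H 0 = 0`. [cite: EntingJensen2009, §7.4.2, Fig. 7.10] -/
theorem stairV_zero (p H : ℕ) : stairV p H 0 = 0 := by unfold stairV; omega

/-- `stairV ≤ H`. [cite: EntingJensen2009, §7.4.2, Fig. 7.10] -/
theorem stairV_le (p H i : ℕ) : stairV p H i ≤ H := by unfold stairV; omega

/-- `2 · stairV ≤ i`. [cite: EntingJensen2009, §7.4.2, Fig. 7.10] -/
theorem two_mul_stairV_le (p H i : ℕ) : 2 * stairV p H i ≤ i := by unfold stairV; omega

/-- One more step adds at most one vertical step. [cite: EntingJensen2009, §7.4.2, Fig. 7.10] -/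
theorem stairV_succ_le (p H i : ℕ) : stairV p H (i + 1) ≤ stairV p H i + 1 := by unfold stairV; omega

/-- `stairV` is monotone. [cite: EntingJensen2009, §7.4.2, Fig. 7.10] -/
theorem stairV_mono (p H : ℕ) {i j : ℕ} (h : i ≤ j) : stairV p H i ≤ stairV p H j := by unfold stairV; omega

/-- After `2H + p` steps all `H` vertical steps are done. [cite: EntingJensen2009, §7.4.2, Fig. 7.10] -/
theorem stairV_of_le {p H i : ℕ} (h : 2 * H + p ≤ i) : stairV p H i = H := by unfold stairV; omega

/-- The staircase starts at the origin. [cite: EntingJensen2009, §7.4.2, Fig. 7.10] -/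
theorem stair_zero (p H : ℕ) (σ : ℤ) (L : ℕ) : stair p H σ L 0 = 0 := by
  refine site_ext₂ ?_ ?_
  · rw [stair_apply_zero, Nat.zero_min, stairV_zero]; simp
  · rw [stair_apply_one, Nat.zero_min, stairV_zero]; simp

/-- The staircase is frozen after `L` steps. [cite: EntingJensen2009, §7.4.2, Fig. 7.10] -/
theorem stair_of_le (p H : ℕ) (σ : ℤ) {L i : ℕ} (h : L ≤ i) : stair p H σ L i = stair p H σ L L := by
  refine site_ext₂ ?_ ?_
  · rw [stair_apply_zero, stair_apply_zero, Nat.min_eq_right h, Nat.min_self]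
  · rw [stair_apply_one, stair_apply_one, Nat.min_eq_right h, Nat.min_self]

/-- First coordinate of the staircase before freezing. [cite: EntingJensen2009, §7.4.2, Fig. 7.10] -/
theorem stair_apply_zero_of_le (p H : ℕ) (σ : ℤ) {L i : ℕ} (h : i ≤ L) :
    stair p H σ L i 0 = (i : ℤ) - (stairV p H i : ℕ) := by
  rw [stair_apply_zero, Nat.min_eq_left h]

/-- Second coordinate of the staircase before freezing. [cite: EntingJensen2009, §7.4.2, Fig. 7.10] -/
theorem stair_apply_one_of_le (p H : ℕ) (σ : ℤ) {L i : ℕ} (h : i ≤ L) :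
    stair p H σ L i 1 = σ * (stairV p H i : ℕ) := by
  rw [stair_apply_one, Nat.min_eq_left h]

/-- Consecutive staircase points are `ℤ²`-neighbours. [cite: EntingJensen2009, §7.4.2, Fig. 7.10] -/
theorem stair_zd_adj (p H : ℕ) {σ : ℤ} (hσ : σ = 1 ∨ σ = -1) {L i : ℕ} (hi : i < L) :
    (zdGraph 2).Adj (stair p H σ L i) (stair p H σ L (i + 1)) := by
  rw [zd_adj_coord, stair_apply_zero_of_le p H σ hi.le, stair_apply_zero_of_le p H σ ((by omega : i + 1 ≤ L)),
    stair_apply_one_of_le p H σ hi.le, stair_apply_one_of_le p H σ ((by omega : i + 1 ≤ L))]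
  unfold stairV
  rcases hσ with rfl | rfl <;> push_cast <;> omega

/-- The staircase is injective on `[0, L]` (for `σ = ±1`: `i = x + |y|`). [cite: EntingJensen2009, §7.4.2, Fig. 7.10] -/
theorem stair_injOn (p H : ℕ) {σ : ℤ} (hσ : σ = 1 ∨ σ = -1) (L : ℕ) :
    Set.InjOn (stair p H σ L) {i | i ≤ L} := by
  intro i hi j hj hij
  simp only [Set.mem_setOf_eq] at hi hj
  have h0 := congrFun hij 0
  have h1 := congrFun hij 1
  rw [stair_apply_zero_of_le p H σ hi, stair_apply_zero_of_le p H σ hj] at h0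
  rw [stair_apply_one_of_le p H σ hi, stair_apply_one_of_le p H σ hj] at h1
  have h1' : (stairV p H i : ℤ) = stairV p H j := by
    rcases hσ with rfl | rfl
    · simpa using h1
    · simpa using h1
  unfold stairV at h0 h1'
  push_cast at h0 h1'
  omega

/-- **The staircase is a self-avoiding walk of `ℤ²` from the origin**, `σ = ±1`. [cite: MadrasSlade1993, §1.1; EntingJensen2009, §7.4.2, Fig. 7.10] -/
theorem stair_mem_zd_saws (p H : ℕ) {σ : ℤ} (hσ : σ = 1 ∨ σ = -1) (L : ℕ) : stair p H σ L ∈ Zd.saws 2 L :=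
  Zd.mem_saws.2 ⟨stair_zero p H σ L, fun _ hi => stair_of_le p H σ hi, fun _ hi => stair_zd_adj p H hσ hi,
    stair_injOn p H hσ L⟩

/-- The abscissa of the staircase is at least `1` from the first step on. [cite: EntingJensen2009, §7.4.2, Fig. 7.10] -/
theorem one_le_stair_apply_zero (p H : ℕ) (σ : ℤ) {L i : ℕ} (hi : 1 ≤ i) (hL : 1 ≤ L) :
    1 ≤ stair p H σ L i 0 := by
  rw [stair_apply_zero]
  have h := two_mul_stairV_le p H (min i L)
  have hm : 1 ≤ min i L := le_min hi hL
  push_cast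
  omega

/-- The abscissa of the staircase is non-decreasing. [cite: EntingJensen2009, §7.4.2, Fig. 7.10] -/
theorem stair_apply_zero_mono (p H : ℕ) (σ : ℤ) (L : ℕ) {i j : ℕ} (h : i ≤ j) :
    stair p H σ L i 0 ≤ stair p H σ L j 0 := by
  rw [stair_apply_zero, stair_apply_zero]
  have hm : min i L ≤ min j L := min_le_min_right L h
  -- `stairV` grows at most like half the time
  have key : ∀ a b : ℕ, a ≤ b → (a : ℤ) - (stairV p H a : ℕ) ≤ (b : ℤ) - (stairV p H b : ℕ) := by
    intro a b hab
    unfold stairV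
    push_cast
    omega
  exact key _ _ hm

/-- The LAST step of a staircase of length `L ≥ 2H + p + 1` is horizontal: every earlier abscissa is at most the final
one minus `1`. [cite: EntingJensen2009, §7.4.2, Fig. 7.10] -/
theorem stair_apply_zero_le_sub_one (p H : ℕ) (σ : ℤ) {L i : ℕ} (hL : 2 * H + p + 1 ≤ L) (hi : i < L) :
    stair p H σ L i 0 ≤ stair p H σ L L 0 - 1 := by
  have h1 : stair p H σ L i 0 ≤ stair p H σ L (L - 1) 0 := stair_apply_zero_mono p H σ L (by omega)
  rw [stair_apply_zero_of_le p H σ (Nat.sub_le L 1), stairV_of_le (by omega : 2 * H + p ≤ L - 1)] at h1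
  rw [stair_apply_zero_of_le p H σ le_rfl, stairV_of_le (by omega : 2 * H + p ≤ L)]
  omega

/-- The endpoint of a staircase of length `L ≥ 2H + p`: `(L − H, σ H)`. [cite: EntingJensen2009, §7.4.2, Fig. 7.10] -/
theorem stair_apply_end (p H : ℕ) (σ : ℤ) {L : ℕ} (hL : 2 * H + p ≤ L) :
    stair p H σ L L 0 = (L : ℤ) - H ∧ stair p H σ L L 1 = σ * H := by
  rw [stair_apply_zero_of_le p H σ le_rfl, stair_apply_one_of_le p H σ le_rfl, stairV_of_le hL]
  exact ⟨rfl, rfl⟩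

/-- **Brick-wall bonds of a placed staircase.**  Placed at a site `B` whose parity is `p + 1` for an ascending
staircase (`σ = 1`) resp. `p` for a descending one (`σ = −1`), consecutive points are brick-wall neighbours: the vertical
steps happen exactly at the sites of even parity (going up) resp. from the sites of odd parity (going down).
[cite: EntingJensen2009, §7.4.2, Fig. 7.10 (brickwork form of the honeycomb lattice: vertical bonds at even x + y)] -/
theorem stair_adj_add (p H : ℕ) {σ : ℤ} (hσ : σ = 1 ∨ σ = -1) (hp : p ≤ 1) {B : Site 2}
    (hB : (B 0 + B 1) % 2 = ((p : ℤ) + (1 + σ) / 2) % 2) {L i : ℕ} (hi : i < L) :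
    brickWallGraph.Adj (B + stair p H σ L i) (B + stair p H σ L (i + 1)) := by
  rw [brickWallGraph_adj_coord]
  simp only [Pi.add_apply]
  rw [stair_apply_zero_of_le p H σ hi.le, stair_apply_zero_of_le p H σ ((by omega : i + 1 ≤ L)),
    stair_apply_one_of_le p H σ hi.le, stair_apply_one_of_le p H σ ((by omega : i + 1 ≤ L))]
  unfold stairV
  rcases hσ with rfl | rfl
  · push_cast at hB ⊢
    omega
  · push_cast at hB ⊢
    omega

/-! ### Completing an unfolded strip walk into an arch or a bridge -/

/-- The parity class `(a₀ + a₁) mod 2 ∈ {0,1}` of a site, as a natural number. [cite: EntingJensen2009, §7.4.2, Fig. 7.10] -/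
def par (a : Site 2) : ℕ := ((a 0 + a 1) % 2).toNat

/-- `(par a : ℤ) = (a₀ + a₁) mod 2`. [cite: EntingJensen2009, §7.4.2, Fig. 7.10] -/
theorem par_cast (a : Site 2) : ((par a : ℕ) : ℤ) = (a 0 + a 1) % 2 := by
  rw [par, Int.toNat_of_nonneg (Int.emod_nonneg _ two_ne_zero)]

/-- `par a ≤ 1`. [cite: EntingJensen2009, §7.4.2, Fig. 7.10] -/
theorem par_le (a : Site 2) : par a ≤ 1 := by
  have h := par_cast a
  have : (a 0 + a 1) % 2 < 2 := Int.emod_lt_of_pos _ two_pos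
  omega

/-- Length of the ascending staircase prepended at a start `a` of the cross-section: `2a₁ + 3 − par a`.
[cite: BeatonBousquetMelouDeGierDuminilCopinGuttmann2014, Proposition 6 (arXiv v5 p. 10; proof p. 11: "concatenation and unfolding arguments as given in Section 4 of [16]")] -/
def preLen (a : Site 2) : ℕ := 2 * (a 1).toNat + 3 - par a

/-- Length of the descending staircase (with its final run along the bottom row) appended for an ARCH, so that the
total added length is `4T + 6`. [cite: BeatonBousquetMelouDeGierDuminilCopinGuttmann2014, Proposition 6 (arXiv v5 p. 10)] -/
def sufLenA (T : ℕ) (a : Site 2) : ℕ := 4 * T + 3 - 2 * (a 1).toNat + par a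

/-- Length of the ascending staircase (with its final run along the top row) appended for a BRIDGE, so that the
total added length is `4T + 7`. [cite: BeatonBousquetMelouDeGierDuminilCopinGuttmann2014, Proposition 6 (arXiv v5 p. 10)] -/
def sufLenB (T : ℕ) (a : Site 2) : ℕ := 4 * T + 4 - 2 * (a 1).toNat + par a

/-- The prepended piece, read from the origin: one step right, then up-right stairs to the row of `a`, then right to
`a` (it reaches `a` from strictly smaller abscissae). [cite: BeatonBousquetMelouDeGierDuminilCopinGuttmann2014, Proposition 6 (arXiv v5 p. 10)] -/
def prePiece (a : Site 2) : ℕ → Site 2 := stair 0 (a 1).toNat 1 (preLen a)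

/-- The appended piece of an arch, read from the end `e` of the unfolded walk (`h = e₁`): right, down-right stairs to the
bottom row, right to a bottom-surface vertex, then along the bottom row. [cite: BeatonBousquetMelouDeGierDuminilCopinGuttmann2014, Proposition 6 (arXiv v5 p. 10)] -/
def sufPieceA (T : ℕ) (a : Site 2) (h : ℕ) : ℕ → Site 2 := stair (par a) h (-1) (sufLenA T a)

/-- The appended piece of a bridge (`h = e₁`): right, up-right stairs to the top row, right to a top-surface vertex, then
along the top row. [cite: BeatonBousquetMelouDeGierDuminilCopinGuttmann2014, Proposition 6 (arXiv v5 p. 10)] -/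
def sufPieceB (T : ℕ) (a : Site 2) (h : ℕ) : ℕ → Site 2 := stair (1 - par a) (T - h) 1 (sufLenB T a)

/-- The bottom-surface start `(1, 0)` of every completed arch / bridge. [cite: BeatonBousquetMelouDeGierDuminilCopinGuttmann2014, §3.2 (arXiv v5 p. 10: walks from a mid-edge just below the bottom of the strip)] -/
def botStart : Site 2 := ![1, 0]

/-- **The arch completion** of an unfolded strip walk `(a, υ)` of length `m`: prepended staircase, the walk, appended
staircase — re-based at the bottom-surface vertex `(1,0)`; total length `m + 4T + 6`.
[cite: BeatonBousquetMelouDeGierDuminilCopinGuttmann2014, Proposition 6 (arXiv v5 p. 10; proof p. 11: "concatenation and unfolding arguments as given in Section 4 of [16]")] -/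
def toArch (T m : ℕ) (q : Site 2 × (ℕ → Site 2)) : Site 2 × (ℕ → Site 2) :=
  (botStart, Zd.concatWalk (preLen q.1) (prePiece q.1)
    (Zd.concatWalk m q.2 (sufPieceA T q.1 ((q.1 + q.2 m) 1).toNat)))

/-- **The bridge completion** of an unfolded strip walk `(a, υ)` of length `m`; total length `m + 4T + 7`.
[cite: BeatonBousquetMelouDeGierDuminilCopinGuttmann2014, Proposition 6 (arXiv v5 p. 10; proof p. 11: "concatenation and unfolding arguments as given in Section 4 of [16]")] -/
def toBridge (T m : ℕ) (q : Site 2 × (ℕ → Site 2)) : Site 2 × (ℕ → Site 2) :=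
  (botStart, Zd.concatWalk (preLen q.1) (prePiece q.1)
    (Zd.concatWalk m q.2 (sufPieceB T q.1 ((q.1 + q.2 m) 1).toNat)))

/-- `botStart` is a starting site of the cross-section and a bottom-surface vertex. [cite: BeatonBousquetMelouDeGierDuminilCopinGuttmann2014, §3.2 (arXiv v5 p. 10)] -/
theorem botStart_spec (T : ℕ) : botStart ∈ stripStarts T ∧ IsBotV botStart := by
  refine ⟨mem_stripStarts.2 ⟨⟨by simp [botStart], by simp [botStart]⟩, by simp [botStart], ?_⟩, ?_⟩
  · simp [botStart]
  · exact ⟨by simp [botStart], by simp [botStart]⟩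

/-- Arithmetic of a start of the cross-section: `0 ≤ a₀ ≤ 1`, `0 ≤ a₁ ≤ T`, `(a₁.toNat : ℤ) = a₁`, `(par a : ℤ) = (a₀+a₁) mod 2`,
`preLen a + sufLenA T a = 4T + 6`, `preLen a + sufLenB T a = 4T + 7`. [cite: MadrasSlade1993, §8.2, eq. (8.2.1)] -/
theorem start_arith {a : Site 2} (ha : a ∈ stripStarts T) :
    0 ≤ a 0 ∧ a 0 ≤ 1 ∧ 0 ≤ a 1 ∧ a 1 ≤ T ∧ (((a 1).toNat : ℕ) : ℤ) = a 1 ∧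
      (((par a : ℕ) : ℤ) = (a 0 + a 1) % 2) ∧ par a ≤ 1 ∧
      preLen a + sufLenA T a = 4 * T + 6 ∧ preLen a + sufLenB T a = 4 * T + 7 ∧
      2 * (a 1).toNat + 1 ≤ preLen a := by
  obtain ⟨⟨h0, h1⟩, h2, h3⟩ := mem_stripStarts.1 ha
  have h4 : (((a 1).toNat : ℕ) : ℤ) = a 1 := Int.toNat_of_nonneg h2
  have h5 := par_cast a
  have h6 := par_le a
  have h7 : (a 1).toNat ≤ T := by omega
  refine ⟨h0, h1, h2, h3, h4, h5, h6, ?_, ?_, ?_⟩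
  · unfold preLen sufLenA; omega
  · unfold preLen sufLenB; omega
  · unfold preLen; omega

/-- The even horizontal shift by which the completed walk, re-based at `(1,0)`, differs from the original placed walk.
[cite: EntingJensen2009, §7.4.2, Fig. 7.10 (translations by even vectors are automorphisms of the brick wall)] -/
def shiftV (a : Site 2) : Site 2 := ![(((a 1).toNat : ℕ) : ℤ) + 4 - (par a : ℕ) - a 0, 0]

/-- The prepended piece ends at `a`, up to the even shift: `(1,0) + prePiece a (preLen a) = shiftV a + a`, and `shiftV a`
is an even horizontal vector. [cite: BeatonBousquetMelouDeGierDuminilCopinGuttmann2014, Proposition 6 (arXiv v5 p. 10)] -/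
theorem botStart_add_prePiece_end {a : Site 2} (ha : a ∈ stripStarts T) :
    botStart + prePiece a (preLen a) = shiftV a + a ∧ (shiftV a 0 + shiftV a 1) % 2 = 0 ∧ shiftV a 1 = 0 := by
  obtain ⟨h0, h1, h2, h3, h4, h5, h6, -, -, h9⟩ := start_arith ha
  have hend := stair_apply_end 0 (a 1).toNat 1 (L := preLen a) (by omega)
  refine ⟨site_ext₂ ?_ ?_, ?_, rfl⟩
  · simp only [Pi.add_apply, prePiece, hend.1, shiftV, botStart]
    simp
    unfold preLen
    push_cast [Nat.cast_sub (show par a ≤ 2 * (a 1).toNat + 3 by omega)]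
    omega
  · simp only [Pi.add_apply, prePiece, hend.2, shiftV, botStart]
    simp
    omega
  · simp only [shiftV]
    simp
    omega

/-- The generic completion: prepended staircase, the walk, an appended piece `S`. [cite: BeatonBousquetMelouDeGierDuminilCopinGuttmann2014, Proposition 6 (arXiv v5 p. 10)] -/
def cmpl (m : ℕ) (q : Site 2 × (ℕ → Site 2)) (S : ℕ → Site 2) : ℕ → Site 2 :=
  Zd.concatWalk (preLen q.1) (prePiece q.1) (Zd.concatWalk m q.2 S)

/-- `toArch` is the generic completion with the arch piece. [cite: BeatonBousquetMelouDeGierDuminilCopinGuttmann2014, Proposition 6 (arXiv v5 p. 10)] -/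
theorem toArch_eq (T m : ℕ) (q : Site 2 × (ℕ → Site 2)) :
    toArch T m q = (botStart, cmpl m q (sufPieceA T q.1 ((q.1 + q.2 m) 1).toNat)) := rfl

/-- `toBridge` is the generic completion with the bridge piece. [cite: BeatonBousquetMelouDeGierDuminilCopinGuttmann2014, Proposition 6 (arXiv v5 p. 10)] -/
theorem toBridge_eq (T m : ℕ) (q : Site 2 × (ℕ → Site 2)) :
    toBridge T m q = (botStart, cmpl m q (sufPieceB T q.1 ((q.1 + q.2 m) 1).toNat)) := rfl

/-- Values of the completion on the prepended piece. [cite: MadrasSlade1993, §1.2, eq. (1.2.15)] -/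
theorem cmpl_apply_pre {m : ℕ} {q : Site 2 × (ℕ → Site 2)} (S : ℕ → Site 2) {i : ℕ} (hi : i ≤ preLen q.1) :
    cmpl m q S i = prePiece q.1 i :=
  Zd.concatWalk_apply_of_le _ _ hi

/-- Values of the completion on the middle piece. [cite: MadrasSlade1993, §1.2, eq. (1.2.15)] -/
theorem cmpl_apply_mid {m : ℕ} {q : Site 2 × (ℕ → Site 2)} {S : ℕ → Site 2} (hq0 : q.2 0 = 0) {j : ℕ}
    (hj : j ≤ m) : cmpl m q S (preLen q.1 + j) = prePiece q.1 (preLen q.1) + q.2 j := by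
  rw [cmpl, Zd.concatWalk_apply_add _ _ (by rw [Zd.concatWalk_apply_of_le _ _ (Nat.zero_le m), hq0]),
    Zd.concatWalk_apply_of_le _ _ hj]

/-- Values of the completion on the appended piece. [cite: MadrasSlade1993, §1.2, eq. (1.2.15)] -/
theorem cmpl_apply_suf {m : ℕ} {q : Site 2 × (ℕ → Site 2)} {S : ℕ → Site 2} (hq0 : q.2 0 = 0) (hS0 : S 0 = 0)
    (j : ℕ) : cmpl m q S (preLen q.1 + (m + j)) = prePiece q.1 (preLen q.1) + (q.2 m + S j) := by
  rw [cmpl, Zd.concatWalk_apply_add _ _ (by rw [Zd.concatWalk_apply_of_le _ _ (Nat.zero_le m), hq0]),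
    Zd.concatWalk_apply_add _ _ hS0]

/-- The facts about an unfolded strip pair used below: the translate starts at `0`, its abscissae lie between `0` and the
final one, every placed vertex is in the strip, the placed walk uses brick-wall bonds, and the END has the parity class
of the START (`m` even). [cite: BeatonBousquetMelouDeGierDuminilCopinGuttmann2014, Proposition 6 (arXiv v5 p. 10); EntingJensen2009, §7.4.2, Fig. 7.10] -/
theorem unf_arith {m : ℕ} {q : Site 2 × (ℕ → Site 2)} (hq : q ∈ unfPairs T m) (hm : m % 2 = 0) :
    q.2 0 = 0 ∧ (∀ i ≤ m, 0 ≤ q.2 i 0 ∧ q.2 i 0 ≤ q.2 m 0) ∧ (∀ i ≤ m, 0 ≤ (q.1 + q.2 i) 1 ∧ (q.1 + q.2 i) 1 ≤ T) ∧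
      (∀ i < m, brickWallGraph.Adj (q.1 + q.2 i) (q.1 + q.2 (i + 1))) ∧
      ((q.1 + q.2 m) 0 + (q.1 + q.2 m) 1) % 2 = (q.1 0 + q.1 1) % 2 := by
  obtain ⟨hqs, hwb⟩ := mem_unfPairs.1 hq
  obtain ⟨ha, hυ, hbw, hstrip⟩ := mem_stripPairs.1 hqs
  have h0 : q.2 0 = 0 := (Zd.mem_saws.1 hυ).1
  refine ⟨h0, fun i hi => ?_, fun i hi => hstrip i hi, hbw, ?_⟩
  · have h := hwb i hi
    rw [h0] at h
    exact ⟨h.1, h.2⟩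
  · have hp := parity_apply (twist_mem_saws hqs) (le_refl m)
    simp only [twistAt_apply_zero] at hp
    have h1 : (twistAt q.1 (q.2 m) 1) % 2 = (q.2 m 1) % 2 := by
      unfold twistAt; split_ifs
      · rfl
      · rw [negY_apply_one]; omega
    simp only [Pi.add_apply]
    omega

/-- The walk followed by a piece leaving to the right is self-avoiding. [cite: MadrasSlade1993, §1.2, eq. (1.2.15)] -/
theorem inner_mem_zd_saws {m : ℕ} {q : Site 2 × (ℕ → Site 2)} (hq : q ∈ unfPairs T m) (hm : m % 2 = 0)
    {S : ℕ → Site 2} {L : ℕ} (hS : S ∈ Zd.saws 2 L) (hSx : ∀ j, 1 ≤ j → 1 ≤ S j 0) :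
    Zd.concatWalk m q.2 S ∈ Zd.saws 2 (m + L) := by
  obtain ⟨-, hυ, -, -⟩ := mem_stripPairs.1 (mem_unfPairs.1 hq).1
  obtain ⟨-, hx, -, -, -⟩ := unf_arith hq hm
  refine Zd.concatWalk_mem_saws hυ hS fun i hi j hj1 _ heq => ?_
  have h1 := (hx i hi).2
  have h2 := hSx j hj1
  have h3 := congrFun heq 0
  simp only [Pi.add_apply] at h3
  omega

/-- Splitting a sum over `[0, k + m + L]` into the three pieces of a completion. [cite: MadrasSlade1993, §1.2, eq. (1.2.15)] -/
private theorem sum_three_split (F : ℕ → ℕ) (k m L : ℕ) :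
    ∑ i ∈ range (k + (m + L) + 1), F i =
      ∑ i ∈ range k, F i + ∑ j ∈ range (m + 1), F (k + j) + ∑ j ∈ range L, F (k + (m + 1 + j)) := by
  rw [show k + (m + L) + 1 = k + ((m + 1) + L) by ring, Finset.sum_range_add, Finset.sum_range_add, add_assoc]

/-- A sum of indicators over a finite set is at most its cardinality. [cite: MadrasSlade1993, §1.2] -/
private theorem sum_ite_le_card (P : ℕ → Prop) [DecidablePred P] (s : Finset ℕ) :
    ∑ i ∈ s, (if P i then 1 else 0) ≤ s.card := by
  rw [Finset.sum_boole, Nat.cast_id]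
  exact Finset.card_filter_le _ _

/-- **The completed walk is a strip walk** from the bottom-surface vertex `(1,0)`, for any appended piece `S` of length
`L ≥ 1` that is a self-avoiding staircase-like walk leaving to the right (`S j ₀ ≥ 1` for `j ≥ 1`), using brick-wall
bonds when placed at the end `e` of the walk, and keeping the second coordinate in `[0, T]`; moreover the surface-visit
counts of the completion exceed those of the walk by at most `preLen + L`, and its endpoint is `shiftV a + (e + S L)`.
[cite: BeatonBousquetMelouDeGierDuminilCopinGuttmann2014, Proposition 6 (arXiv v5 p. 10; proof p. 11: "concatenation and unfolding arguments as given in Section 4 of [16]"); MadrasSlade1993, §1.2, eq. (1.2.15)] -/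
theorem cmpl_spec {m : ℕ} {q : Site 2 × (ℕ → Site 2)} (hq : q ∈ unfPairs T m) (hm : m % 2 = 0)
    {S : ℕ → Site 2} {L : ℕ} (hS : S ∈ Zd.saws 2 L) (hSx : ∀ j, 1 ≤ j → 1 ≤ S j 0)
    (hSadj : ∀ j < L, brickWallGraph.Adj ((q.1 + q.2 m) + S j) ((q.1 + q.2 m) + S (j + 1)))
    (hSy : ∀ j ≤ L, 0 ≤ (q.1 + q.2 m) 1 + S j 1 ∧ (q.1 + q.2 m) 1 + S j 1 ≤ T) :
    (botStart, cmpl m q S) ∈ stripPairs T (preLen q.1 + (m + L)) ∧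
      bottomVisits₀ q.1 q.2 m ≤ bottomVisits₀ botStart (cmpl m q S) (preLen q.1 + (m + L)) ∧
      bottomVisits₀ botStart (cmpl m q S) (preLen q.1 + (m + L)) ≤ bottomVisits₀ q.1 q.2 m + (preLen q.1 + L) ∧
      topVisits₀ T q.1 q.2 m ≤ topVisits₀ T botStart (cmpl m q S) (preLen q.1 + (m + L)) ∧
      topVisits₀ T botStart (cmpl m q S) (preLen q.1 + (m + L)) ≤ topVisits₀ T q.1 q.2 m + (preLen q.1 + L) ∧
      botStart + cmpl m q S (preLen q.1 + (m + L)) = shiftV q.1 + ((q.1 + q.2 m) + S L) := by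
  obtain ⟨hqs, hwb⟩ := mem_unfPairs.1 hq
  obtain ⟨ha, hυ, hbw, hstrip⟩ := mem_stripPairs.1 hqs
  obtain ⟨h0, hx, hy, -, hpar⟩ := unf_arith hq hm
  obtain ⟨a, υ⟩ := q
  dsimp only at *
  obtain ⟨ha0, ha1, ha2, ha3, ha4, ha5, ha6, -, -, ha9⟩ := start_arith ha
  obtain ⟨hsh, hsh2, hsh1⟩ := botStart_add_prePiece_end ha
  obtain ⟨hS0, hSend, -, hSinj⟩ := Zd.mem_saws.1 hS
  set e := a + υ m with he
  -- the three evaluation rules, placed at `botStart`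
  have ev_pre : ∀ i ≤ preLen a, botStart + cmpl m (a, υ) S i = botStart + prePiece a i := fun i hi => by
    rw [cmpl_apply_pre S hi]
  have ev_mid : ∀ j ≤ m, botStart + cmpl m (a, υ) S (preLen a + j) = shiftV a + (a + υ j) := fun j hj => by
    rw [cmpl_apply_mid h0 hj, ← add_assoc, hsh, add_assoc]
  have ev_suf : ∀ j, botStart + cmpl m (a, υ) S (preLen a + (m + j)) = shiftV a + (e + S j) := fun j => by
    rw [cmpl_apply_suf h0 hS0 j, ← add_assoc, hsh, he]; abel
  -- the inner concatenation is a `Zd` walk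
  have hinner : Zd.concatWalk m υ S ∈ Zd.saws 2 (m + L) := inner_mem_zd_saws hq hm hS hSx
  -- the prepended piece is a `Zd` walk
  have hpre : prePiece a ∈ Zd.saws 2 (preLen a) := stair_mem_zd_saws 0 _ (Or.inl rfl) _
  -- the whole completion is a `Zd` walk
  have hzd : cmpl m (a, υ) S ∈ Zd.saws 2 (preLen a + (m + L)) := by
    refine Zd.concatWalk_mem_saws hpre hinner fun i hi j hj1 hj2 heq => ?_
    rcases lt_or_eq_of_le hi with hi' | rfl
    · -- `i < k`: abscissa of the prepended piece is `≤ end − 1`, the rest is `≥ end`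
      have h1 := stair_apply_zero_le_sub_one 0 (a 1).toNat 1 (L := preLen a) (by omega) hi'
      have h3 := congrFun heq 0
      simp only [Pi.add_apply, prePiece] at h3 h1
      -- abscissa of the inner walk at time `j ≥ 1` is `≥ 0`
      have h4 : 0 ≤ Zd.concatWalk m υ S j 0 := by
        rcases le_or_gt j m with hjm | hjm
        · rw [Zd.concatWalk_apply_of_le _ _ hjm]; exact (hx j hjm).1
        · obtain ⟨j', rfl⟩ : ∃ j', j = m + j' := ⟨j - m, by omega⟩
          rw [Zd.concatWalk_apply_add _ _ hS0, Pi.add_apply]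
          have := hSx j' (by omega)
          have := (hx m le_rfl).1
          omega
      omega
    · -- `i = k`: the inner walk does not return to its start
      have hne : Zd.concatWalk m υ S j ≠ Zd.concatWalk m υ S 0 := fun h' =>
        absurd ((Zd.mem_saws.1 hinner).2.2.2 (show j ∈ {i | i ≤ m + L} by simpa using hj2)
          (show 0 ∈ {i | i ≤ m + L} by simp) h') (by omega)
      apply hne
      rw [Zd.concatWalk_apply_of_le _ _ (Nat.zero_le m), h0]
      have := heq
      rw [eq_comm, add_eq_left] at this
      exact this
  -- parity of `shiftV a 0`
  have hsh0 : shiftV a 0 % 2 = 0 := by rw [hsh1, add_zero] at hsh2; exact hsh2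
  -- brick-wall bonds of the placed completion
  have hbw' : IsBW (preLen a + (m + L)) (fun i => botStart + cmpl m (a, υ) S i) := by
    intro i hi
    show brickWallGraph.Adj (botStart + cmpl m (a, υ) S i) (botStart + cmpl m (a, υ) S (i + 1))
    rcases lt_or_ge i (preLen a) with h1 | h1
    · rw [ev_pre i h1.le, ev_pre (i + 1) h1]
      exact stair_adj_add 0 (a 1).toNat (Or.inl rfl) (Nat.zero_le 1) (B := botStart)
        (by simp [botStart]) h1
    · obtain ⟨j, rfl⟩ : ∃ j, i = preLen a + j := ⟨i - preLen a, by omega⟩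
      rcases lt_or_ge j m with h2 | h2
      · rw [ev_mid j h2.le, show preLen a + j + 1 = preLen a + (j + 1) by ring, ev_mid (j + 1) h2,
          adj_add_left_iff_of_even hsh2]
        exact hbw j h2
      · obtain ⟨j', rfl⟩ : ∃ j', j = m + j' := ⟨j - m, by omega⟩
        have hj' : j' < L := by omega
        rw [ev_suf j', show preLen a + (m + j') + 1 = preLen a + (m + (j' + 1)) by ring, ev_suf (j' + 1),
          adj_add_left_iff_of_even hsh2]
        exact hSadj j' hj'
  -- the placed completion stays in the strip
  have hstrip' : ∀ i ≤ preLen a + (m + L), InStrip T (botStart + cmpl m (a, υ) S i) := by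
    intro i hi
    rcases le_or_gt i (preLen a) with h1 | h1
    · rw [ev_pre i h1]
      have hv := stairV_le 0 (a 1).toNat (min i (preLen a))
      simp only [InStrip, Pi.add_apply, prePiece, stair_apply_one, one_mul, botStart]
      simp
      omega
    · obtain ⟨j, rfl⟩ : ∃ j, i = preLen a + j := ⟨i - preLen a, by omega⟩
      rcases le_or_gt j m with h2 | h2
      · rw [ev_mid j h2]
        have h := hy j h2
        simp only [InStrip, Pi.add_apply, hsh1, zero_add] at h ⊢
        exact h
      · obtain ⟨j', rfl⟩ : ∃ j', j = m + j' := ⟨j - m, by omega⟩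
        rw [ev_suf j']
        have h := hSy j' (by omega)
        simp only [InStrip, Pi.add_apply, hsh1, zero_add] at h ⊢
        exact h
  have hmem : (botStart, cmpl m (a, υ) S) ∈ stripPairs T (preLen a + (m + L)) :=
    mem_stripPairs.2 ⟨(botStart_spec T).1, hzd, hbw', hstrip'⟩
  -- surface visits: the middle piece contributes exactly the visits of `(a, υ)`
  have hmidB : ∀ j ∈ range (m + 1),
      (if (botStart + cmpl m (a, υ) S (preLen a + j)) 1 = 0 ∧ (botStart + cmpl m (a, υ) S (preLen a + j)) 0 % 2 = 1
        then 1 else 0) = (if (a + υ j) 1 = 0 ∧ (a + υ j) 0 % 2 = 1 then 1 else 0) := by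
    intro j hj
    have hj' : j ≤ m := Nat.lt_succ_iff.1 (Finset.mem_range.1 hj)
    have e1 : (shiftV a + (a + υ j)) 1 = (a + υ j) 1 := by simp only [Pi.add_apply, hsh1, zero_add]
    have e0 : (shiftV a + (a + υ j)) 0 % 2 = (a + υ j) 0 % 2 := by simp only [Pi.add_apply]; omega
    rw [ev_mid j hj', e1, e0]
  have hmidT : ∀ j ∈ range (m + 1),
      (if (botStart + cmpl m (a, υ) S (preLen a + j)) 1 = (T : ℤ) ∧
          ((botStart + cmpl m (a, υ) S (preLen a + j)) 0 + T) % 2 = 0 then 1 else 0) =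
        (if (a + υ j) 1 = (T : ℤ) ∧ ((a + υ j) 0 + T) % 2 = 0 then 1 else 0) := by
    intro j hj
    have hj' : j ≤ m := Nat.lt_succ_iff.1 (Finset.mem_range.1 hj)
    have e1 : (shiftV a + (a + υ j)) 1 = (a + υ j) 1 := by simp only [Pi.add_apply, hsh1, zero_add]
    have e0 : ((shiftV a + (a + υ j)) 0 + T) % 2 = ((a + υ j) 0 + T) % 2 := by simp only [Pi.add_apply]; omega
    rw [ev_mid j hj', e1, e0]
  have hB : bottomVisits₀ botStart (cmpl m (a, υ) S) (preLen a + (m + L)) =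
      (∑ i ∈ range (preLen a), if (botStart + cmpl m (a, υ) S i) 1 = 0 ∧ (botStart + cmpl m (a, υ) S i) 0 % 2 = 1
          then 1 else 0) + bottomVisits₀ a υ m +
      ∑ j ∈ range L, (if (botStart + cmpl m (a, υ) S (preLen a + (m + 1 + j))) 1 = 0 ∧
          (botStart + cmpl m (a, υ) S (preLen a + (m + 1 + j))) 0 % 2 = 1 then 1 else 0) := by
    unfold bottomVisits₀
    rw [sum_three_split, Finset.sum_congr rfl hmidB]
  have hTp : topVisits₀ T botStart (cmpl m (a, υ) S) (preLen a + (m + L)) =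
      (∑ i ∈ range (preLen a), if (botStart + cmpl m (a, υ) S i) 1 = (T : ℤ) ∧
          ((botStart + cmpl m (a, υ) S i) 0 + T) % 2 = 0 then 1 else 0) + topVisits₀ T a υ m +
      ∑ j ∈ range L, (if (botStart + cmpl m (a, υ) S (preLen a + (m + 1 + j))) 1 = (T : ℤ) ∧
          ((botStart + cmpl m (a, υ) S (preLen a + (m + 1 + j))) 0 + T) % 2 = 0 then 1 else 0) := by
    unfold topVisits₀
    rw [sum_three_split, Finset.sum_congr rfl hmidT]
  have hc1 := Finset.card_range (preLen a)
  have hc2 := Finset.card_range L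
  refine ⟨hmem, ?_, ?_, ?_, ?_, ev_suf L⟩
  · rw [hB]; omega
  · rw [hB]
    have h1 := sum_ite_le_card (fun i => (botStart + cmpl m (a, υ) S i) 1 = 0 ∧
      (botStart + cmpl m (a, υ) S i) 0 % 2 = 1) (range (preLen a))
    have h2 := sum_ite_le_card (fun j => (botStart + cmpl m (a, υ) S (preLen a + (m + 1 + j))) 1 = 0 ∧
      (botStart + cmpl m (a, υ) S (preLen a + (m + 1 + j))) 0 % 2 = 1) (range L)
    omega
  · rw [hTp]; omega
  · rw [hTp]
    have h1 := sum_ite_le_card (fun i => (botStart + cmpl m (a, υ) S i) 1 = (T : ℤ) ∧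
      ((botStart + cmpl m (a, υ) S i) 0 + T) % 2 = 0) (range (preLen a))
    have h2 := sum_ite_le_card (fun j => (botStart + cmpl m (a, υ) S (preLen a + (m + 1 + j))) 1 = (T : ℤ) ∧
      ((botStart + cmpl m (a, υ) S (preLen a + (m + 1 + j))) 0 + T) % 2 = 0) (range L)
    omega

/-- **The arch completion is an arch of length `m + 4T + 6` whose surface-visit counts exceed those of the walk by at
most `4T + 6`.** [cite: BeatonBousquetMelouDeGierDuminilCopinGuttmann2014, Proposition 6 (arXiv v5 p. 10; proof p. 11: "concatenation and unfolding arguments as given in Section 4 of [16]")] -/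
theorem toArch_spec {m : ℕ} {q : Site 2 × (ℕ → Site 2)} (hq : q ∈ unfPairs T m) (hm : m % 2 = 0) :
    toArch T m q ∈ archPairs T (m + (4 * T + 6)) ∧
      bottomVisits₀ q.1 q.2 m ≤ bottomVisits₀ (toArch T m q).1 (toArch T m q).2 (m + (4 * T + 6)) ∧
      bottomVisits₀ (toArch T m q).1 (toArch T m q).2 (m + (4 * T + 6)) ≤ bottomVisits₀ q.1 q.2 m + (4 * T + 6) ∧
      topVisits₀ T q.1 q.2 m ≤ topVisits₀ T (toArch T m q).1 (toArch T m q).2 (m + (4 * T + 6)) ∧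
      topVisits₀ T (toArch T m q).1 (toArch T m q).2 (m + (4 * T + 6)) ≤ topVisits₀ T q.1 q.2 m + (4 * T + 6) := by
  rw [toArch_eq]
  dsimp only
  obtain ⟨hqs, -⟩ := mem_unfPairs.1 hq
  obtain ⟨ha, -, -, -⟩ := mem_stripPairs.1 hqs
  obtain ⟨-, -, hy, -, hpar⟩ := unf_arith hq hm
  obtain ⟨ha0, ha1, ha2, ha3, ha4, ha5, ha6, ha7, -, ha9⟩ := start_arith ha
  obtain ⟨-, hsh2, hsh1⟩ := botStart_add_prePiece_end ha
  have hsh0 : shiftV q.1 0 % 2 = 0 := by rw [hsh1, add_zero] at hsh2; exact hsh2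
  -- the end of the walk and its height
  have he := hy m le_rfl
  simp only [Pi.add_apply] at he hpar
  set E := ((q.1 + q.2 m) 1).toNat with hE
  have hEz : ((E : ℕ) : ℤ) = q.1 1 + q.2 m 1 := Int.toNat_of_nonneg he.1
  have hET : E ≤ T := by omega
  have hLz : ((sufLenA T q.1 : ℕ) : ℤ) = 4 * (T : ℤ) + 3 - 2 * (((q.1 1).toNat : ℕ) : ℤ) + ((par q.1 : ℕ) : ℤ) := by
    unfold sufLenA; omega
  -- the appended piece
  have hS : sufPieceA T q.1 E ∈ Zd.saws 2 (sufLenA T q.1) := stair_mem_zd_saws _ _ (Or.inr rfl) _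
  have hSx : ∀ j, 1 ≤ j → 1 ≤ sufPieceA T q.1 E j 0 := fun j hj =>
    one_le_stair_apply_zero _ _ _ hj (by unfold sufLenA preLen at *; omega)
  have hSadj : ∀ j < sufLenA T q.1,
      brickWallGraph.Adj ((q.1 + q.2 m) + sufPieceA T q.1 E j) ((q.1 + q.2 m) + sufPieceA T q.1 E (j + 1)) :=
    fun j hj => stair_adj_add (par q.1) E (Or.inr rfl) ha6 (B := q.1 + q.2 m)
      (by simp only [Pi.add_apply]; push_cast; omega) hj
  have hSy : ∀ j ≤ sufLenA T q.1,
      0 ≤ (q.1 + q.2 m) 1 + sufPieceA T q.1 E j 1 ∧ (q.1 + q.2 m) 1 + sufPieceA T q.1 E j 1 ≤ T := by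
    intro j hj
    have hv := stairV_le (par q.1) E (min j (sufLenA T q.1))
    simp only [sufPieceA, stair_apply_one, Pi.add_apply]
    constructor <;> omega
  obtain ⟨hmem, hb1, hb2, ht1, ht2, hend⟩ := cmpl_spec hq hm hS hSx hSadj hSy
  have hn : preLen q.1 + (m + sufLenA T q.1) = m + (4 * T + 6) := by omega
  rw [hn] at hmem hb1 hb2 ht1 ht2 hend
  rw [ha7] at hb2 ht2
  refine ⟨mem_archPairs.2 ⟨hmem, (botStart_spec T).2, ?_⟩, hb1, hb2, ht1, ht2⟩
  -- the endpoint is a bottom-surface vertex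
  have hSe := stair_apply_end (par q.1) E (-1) (L := sufLenA T q.1) (by unfold sufLenA; omega)
  dsimp only
  rw [hend]
  refine ⟨?_, ?_⟩
  · simp only [Pi.add_apply, hsh1, sufPieceA, hSe.2]; omega
  · simp only [Pi.add_apply, sufPieceA, hSe.1]; omega

/-- **The bridge completion is a bridge of length `m + 4T + 7` whose surface-visit counts exceed those of the walk by at
most `4T + 7`.** [cite: BeatonBousquetMelouDeGierDuminilCopinGuttmann2014, Proposition 6 (arXiv v5 p. 10; proof p. 11: "concatenation and unfolding arguments as given in Section 4 of [16]")] -/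
theorem toBridge_spec {m : ℕ} {q : Site 2 × (ℕ → Site 2)} (hq : q ∈ unfPairs T m) (hm : m % 2 = 0) :
    toBridge T m q ∈ bridgePairs T (m + (4 * T + 7)) ∧
      bottomVisits₀ q.1 q.2 m ≤ bottomVisits₀ (toBridge T m q).1 (toBridge T m q).2 (m + (4 * T + 7)) ∧
      bottomVisits₀ (toBridge T m q).1 (toBridge T m q).2 (m + (4 * T + 7)) ≤ bottomVisits₀ q.1 q.2 m + (4 * T + 7) ∧
      topVisits₀ T q.1 q.2 m ≤ topVisits₀ T (toBridge T m q).1 (toBridge T m q).2 (m + (4 * T + 7)) ∧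
      topVisits₀ T (toBridge T m q).1 (toBridge T m q).2 (m + (4 * T + 7)) ≤ topVisits₀ T q.1 q.2 m + (4 * T + 7) := by
  rw [toBridge_eq]
  dsimp only
  obtain ⟨hqs, -⟩ := mem_unfPairs.1 hq
  obtain ⟨ha, -, -, -⟩ := mem_stripPairs.1 hqs
  obtain ⟨-, -, hy, -, hpar⟩ := unf_arith hq hm
  obtain ⟨ha0, ha1, ha2, ha3, ha4, ha5, ha6, -, ha8, ha9⟩ := start_arith ha
  obtain ⟨-, hsh2, hsh1⟩ := botStart_add_prePiece_end ha
  have hsh0 : shiftV q.1 0 % 2 = 0 := by rw [hsh1, add_zero] at hsh2; exact hsh2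
  have he := hy m le_rfl
  simp only [Pi.add_apply] at he hpar
  set E := ((q.1 + q.2 m) 1).toNat with hE
  have hEz : ((E : ℕ) : ℤ) = q.1 1 + q.2 m 1 := Int.toNat_of_nonneg he.1
  have hET : E ≤ T := by omega
  have hLz : ((sufLenB T q.1 : ℕ) : ℤ) = 4 * (T : ℤ) + 4 - 2 * (((q.1 1).toNat : ℕ) : ℤ) + ((par q.1 : ℕ) : ℤ) := by
    unfold sufLenB; omega
  have hpz : (((1 - par q.1 : ℕ) : ℕ) : ℤ) = 1 - ((par q.1 : ℕ) : ℤ) := by omega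
  have hTE : (((T - E : ℕ) : ℕ) : ℤ) = (T : ℤ) - E := by omega
  have hS : sufPieceB T q.1 E ∈ Zd.saws 2 (sufLenB T q.1) := stair_mem_zd_saws _ _ (Or.inl rfl) _
  have hSx : ∀ j, 1 ≤ j → 1 ≤ sufPieceB T q.1 E j 0 := fun j hj =>
    one_le_stair_apply_zero _ _ _ hj (by unfold sufLenB preLen at *; omega)
  have hSadj : ∀ j < sufLenB T q.1,
      brickWallGraph.Adj ((q.1 + q.2 m) + sufPieceB T q.1 E j) ((q.1 + q.2 m) + sufPieceB T q.1 E (j + 1)) :=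
    fun j hj => stair_adj_add (1 - par q.1) (T - E) (Or.inl rfl) (by omega) (B := q.1 + q.2 m)
      (by simp only [Pi.add_apply]; push_cast [hpz]; omega) hj
  have hSy : ∀ j ≤ sufLenB T q.1,
      0 ≤ (q.1 + q.2 m) 1 + sufPieceB T q.1 E j 1 ∧ (q.1 + q.2 m) 1 + sufPieceB T q.1 E j 1 ≤ T := by
    intro j hj
    have hv := stairV_le (1 - par q.1) (T - E) (min j (sufLenB T q.1))
    simp only [sufPieceB, stair_apply_one, Pi.add_apply]
    constructor <;> omega
  obtain ⟨hmem, hb1, hb2, ht1, ht2, hend⟩ := cmpl_spec hq hm hS hSx hSadj hSy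
  have hn : preLen q.1 + (m + sufLenB T q.1) = m + (4 * T + 7) := by omega
  rw [hn] at hmem hb1 hb2 ht1 ht2 hend
  rw [ha8] at hb2 ht2
  refine ⟨mem_bridgePairs.2 ⟨hmem, (botStart_spec T).2, ?_⟩, hb1, hb2, ht1, ht2⟩
  -- the endpoint is a top-surface vertex
  have hSe := stair_apply_end (1 - par q.1) (T - E) 1 (L := sufLenB T q.1) (by unfold sufLenB; omega)
  dsimp only
  rw [hend]
  refine ⟨?_, ?_⟩
  · simp only [Pi.add_apply, hsh1, sufPieceB, hSe.2]; push_cast [hTE]; omega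
  · simp only [Pi.add_apply, sufPieceB, hSe.1]; push_cast [hTE]; omega

/-- On the unfolded pairs with a common start, the arch completion is injective. [cite: MadrasSlade1993, §1.2, eq. (1.2.15) (p. 11: concatenation of bridges, b_M b_N ≤ b_{M+N})] -/
theorem toArch_injOn {m : ℕ} (hm : m % 2 = 0) (a₀ : Site 2) :
    Set.InjOn (toArch T m) {q | q ∈ unfPairs T m ∧ q.1 = a₀} := by
  rintro ⟨a, υ⟩ ⟨hq, hqa⟩ ⟨a', υ'⟩ ⟨hq', hqa'⟩ h
  dsimp only at hqa hqa'
  have ea : a' = a := hqa'.trans hqa.symm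
  rw [ea] at hq' h
  have ha : a ∈ stripStarts T := (mem_stripPairs.1 (mem_unfPairs.1 hq).1).1
  obtain ⟨-, -, -, ha3, ha4, -, ha6, ha7, ha8, -⟩ := start_arith ha
  have hpre : prePiece a ∈ Zd.saws 2 (preLen a) := stair_mem_zd_saws 0 _ (Or.inl rfl) _
  have hυ : υ ∈ Zd.saws 2 m := (mem_stripPairs.1 (mem_unfPairs.1 hq).1).2.1
  have hυ' : υ' ∈ Zd.saws 2 m := (mem_stripPairs.1 (mem_unfPairs.1 hq').1).2.1
  have hS : sufPieceA T a ((a + υ m) 1).toNat ∈ Zd.saws 2 (sufLenA T a) := stair_mem_zd_saws _ _ (Or.inr rfl) _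
  have hS' : sufPieceA T a ((a + υ' m) 1).toNat ∈ Zd.saws 2 (sufLenA T a) := stair_mem_zd_saws _ _ (Or.inr rfl) _
  have hx : ∀ j, 1 ≤ j → 1 ≤ sufPieceA T a ((a + υ m) 1).toNat j 0 := fun j hj =>
    one_le_stair_apply_zero _ _ _ hj (by unfold sufLenA preLen at *; omega)
  have hx' : ∀ j, 1 ≤ j → 1 ≤ sufPieceA T a ((a + υ' m) 1).toNat j 0 := fun j hj =>
    one_le_stair_apply_zero _ _ _ hj (by unfold sufLenA preLen at *; omega)
  have hin := inner_mem_zd_saws hq hm hS hx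
  have hin' := inner_mem_zd_saws hq' hm hS' hx'
  have h2 : cmpl m (a, υ) (sufPieceA T a ((a + υ m) 1).toNat) =
      cmpl m (a, υ') (sufPieceA T a ((a + υ' m) 1).toNat) := by
    have := congrArg Prod.snd h
    simpa only [toArch_eq] using this
  have h3 := (Zd.concatWalk_injective_pieces hpre hin hpre hin' h2).2
  have h4 := (Zd.concatWalk_injective_pieces hυ hS hυ' hS' h3).1
  rw [ea, h4]

/-- On the unfolded pairs with a common start, the bridge completion is injective. [cite: MadrasSlade1993, §1.2, eq. (1.2.15) (p. 11: concatenation of bridges, b_M b_N ≤ b_{M+N})] -/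
theorem toBridge_injOn {m : ℕ} (hm : m % 2 = 0) (a₀ : Site 2) :
    Set.InjOn (toBridge T m) {q | q ∈ unfPairs T m ∧ q.1 = a₀} := by
  rintro ⟨a, υ⟩ ⟨hq, hqa⟩ ⟨a', υ'⟩ ⟨hq', hqa'⟩ h
  dsimp only at hqa hqa'
  have ea : a' = a := hqa'.trans hqa.symm
  rw [ea] at hq' h
  have ha : a ∈ stripStarts T := (mem_stripPairs.1 (mem_unfPairs.1 hq).1).1
  obtain ⟨-, -, -, ha3, ha4, -, ha6, ha7, ha8, -⟩ := start_arith ha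
  have hpre : prePiece a ∈ Zd.saws 2 (preLen a) := stair_mem_zd_saws 0 _ (Or.inl rfl) _
  have hυ : υ ∈ Zd.saws 2 m := (mem_stripPairs.1 (mem_unfPairs.1 hq).1).2.1
  have hυ' : υ' ∈ Zd.saws 2 m := (mem_stripPairs.1 (mem_unfPairs.1 hq').1).2.1
  have hS : sufPieceB T a ((a + υ m) 1).toNat ∈ Zd.saws 2 (sufLenB T a) := stair_mem_zd_saws _ _ (Or.inl rfl) _
  have hS' : sufPieceB T a ((a + υ' m) 1).toNat ∈ Zd.saws 2 (sufLenB T a) := stair_mem_zd_saws _ _ (Or.inl rfl) _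
  have hx : ∀ j, 1 ≤ j → 1 ≤ sufPieceB T a ((a + υ m) 1).toNat j 0 := fun j hj =>
    one_le_stair_apply_zero _ _ _ hj (by unfold sufLenB preLen at *; omega)
  have hx' : ∀ j, 1 ≤ j → 1 ≤ sufPieceB T a ((a + υ' m) 1).toNat j 0 := fun j hj =>
    one_le_stair_apply_zero _ _ _ hj (by unfold sufLenB preLen at *; omega)
  have hin := inner_mem_zd_saws hq hm hS hx
  have hin' := inner_mem_zd_saws hq' hm hS' hx'
  have h2 : cmpl m (a, υ) (sufPieceB T a ((a + υ m) 1).toNat) =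
      cmpl m (a, υ') (sufPieceB T a ((a + υ' m) 1).toNat) := by
    have := congrArg Prod.snd h
    simpa only [toBridge_eq] using this
  have h3 := (Zd.concatWalk_injective_pieces hpre hin hpre hin' h2).2
  have h4 := (Zd.concatWalk_injective_pieces hυ hS hυ' hS' h3).1
  rw [ea, h4]

/-! ### The weighted comparison `U_{T,m}(y,z) ≤ K · A_{T,m+4T+6}(y,z)` -/

/-- Bounded change of an exponent costs a bounded power of `max(1, y⁻¹)`: `b ≤ b' ≤ b + K → y^b ≤ yK(y)^K · y^{b'}`.
[cite: BeatonBousquetMelouDeGierDuminilCopinGuttmann2014, Proposition 6 (arXiv v5 p. 10; proof p. 11: "concatenation and unfolding arguments as given in Section 4 of [16]")] -/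
theorem pow_le_yK_pow_mul (hy : 0 < y) {b b' K : ℕ} (h1 : b ≤ b') (h2 : b' ≤ b + K) :
    y ^ b ≤ yK y ^ K * y ^ b' := by
  obtain ⟨d, rfl⟩ := Nat.exists_eq_add_of_le h1
  have hd : d ≤ K := by omega
  have hK1 : 1 ≤ yK y := one_le_yK y
  have h3 : 1 ≤ yK y * y := by
    have := inv_le_yK y
    calc (1 : ℝ) = y⁻¹ * y := by field_simp
      _ ≤ yK y * y := mul_le_mul_of_nonneg_right this hy.le
  have h4 : 1 ≤ (yK y * y) ^ d := one_le_pow₀ h3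
  have h5 : yK y ^ d ≤ yK y ^ K := pow_le_pow_right₀ hK1 hd
  calc y ^ b = y ^ b * 1 := (mul_one _).symm
    _ ≤ y ^ b * (yK y * y) ^ d := mul_le_mul_of_nonneg_left h4 (pow_nonneg hy.le _)
    _ = yK y ^ d * y ^ (b + d) := by rw [mul_pow, pow_add]; ring
    _ ≤ yK y ^ K * y ^ (b + d) := mul_le_mul_of_nonneg_right h5 (pow_nonneg hy.le _)

open Classical in
/-- The fibrewise step: over the unfolded pairs with a fixed start `a`, an injective weight-respecting map into a set of
pairs bounds the weighted sum. [cite: BeatonBousquetMelouDeGierDuminilCopinGuttmann2014, Proposition 6 (arXiv v5 p. 10)] -/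
theorem sum_fibre_le_of_injOn (T m n K : ℕ) (hy : 0 < y) (hz : 0 < z) (a : Site 2)
    (Φ : Site 2 × (ℕ → Site 2) → Site 2 × (ℕ → Site 2)) (P : Finset (Site 2 × (ℕ → Site 2)))
    (hΦ : ∀ q ∈ unfPairs T m, Φ q ∈ P ∧
      bottomVisits₀ q.1 q.2 m ≤ bottomVisits₀ (Φ q).1 (Φ q).2 n ∧
      bottomVisits₀ (Φ q).1 (Φ q).2 n ≤ bottomVisits₀ q.1 q.2 m + K ∧
      topVisits₀ T q.1 q.2 m ≤ topVisits₀ T (Φ q).1 (Φ q).2 n ∧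
      topVisits₀ T (Φ q).1 (Φ q).2 n ≤ topVisits₀ T q.1 q.2 m + K)
    (hinj : Set.InjOn Φ {q | q ∈ unfPairs T m ∧ q.1 = a}) :
    ∑ q ∈ (unfPairs T m).filter (fun q => q.1 = a), y ^ bottomVisits₀ q.1 q.2 m * z ^ topVisits₀ T q.1 q.2 m ≤
      (yK y * yK z) ^ K * ∑ p ∈ P, y ^ bottomVisits₀ p.1 p.2 n * z ^ topVisits₀ T p.1 p.2 n := by
  set F := (unfPairs T m).filter (fun q => q.1 = a) with hF
  have hterm : ∀ q ∈ F, y ^ bottomVisits₀ q.1 q.2 m * z ^ topVisits₀ T q.1 q.2 m ≤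
      (yK y * yK z) ^ K * (y ^ bottomVisits₀ (Φ q).1 (Φ q).2 n * z ^ topVisits₀ T (Φ q).1 (Φ q).2 n) := by
    intro q hq
    obtain ⟨-, h1, h2, h3, h4⟩ := hΦ q (Finset.mem_filter.1 hq).1
    have hb := pow_le_yK_pow_mul hy h1 h2
    have ht := pow_le_yK_pow_mul hz h3 h4
    calc y ^ bottomVisits₀ q.1 q.2 m * z ^ topVisits₀ T q.1 q.2 m
        ≤ (yK y ^ K * y ^ bottomVisits₀ (Φ q).1 (Φ q).2 n) * (yK z ^ K * z ^ topVisits₀ T (Φ q).1 (Φ q).2 n) :=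
          mul_le_mul hb ht (pow_nonneg hz.le _) (mul_nonneg (pow_nonneg (zero_le_one.trans (one_le_yK y)) _)
            (pow_nonneg hy.le _))
      _ = (yK y * yK z) ^ K * (y ^ bottomVisits₀ (Φ q).1 (Φ q).2 n * z ^ topVisits₀ T (Φ q).1 (Φ q).2 n) := by
          rw [mul_pow]; ring
  have hinjF : Set.InjOn Φ ↑F := fun q hq q' hq' h =>
    hinj (by simpa [hF] using hq) (by simpa [hF] using hq') h
  have himg : F.image Φ ⊆ P := by
    intro p hp
    obtain ⟨q, hq, rfl⟩ := Finset.mem_image.1 hp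
    exact (hΦ q (Finset.mem_filter.1 hq).1).1
  calc ∑ q ∈ F, y ^ bottomVisits₀ q.1 q.2 m * z ^ topVisits₀ T q.1 q.2 m
      ≤ ∑ q ∈ F, (yK y * yK z) ^ K * (y ^ bottomVisits₀ (Φ q).1 (Φ q).2 n * z ^ topVisits₀ T (Φ q).1 (Φ q).2 n) :=
        Finset.sum_le_sum hterm
    _ = (yK y * yK z) ^ K * ∑ q ∈ F, y ^ bottomVisits₀ (Φ q).1 (Φ q).2 n * z ^ topVisits₀ T (Φ q).1 (Φ q).2 n := by
        rw [Finset.mul_sum]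
    _ = (yK y * yK z) ^ K * ∑ p ∈ F.image Φ, y ^ bottomVisits₀ p.1 p.2 n * z ^ topVisits₀ T p.1 p.2 n := by
        rw [Finset.sum_image hinjF]
    _ ≤ (yK y * yK z) ^ K * ∑ p ∈ P, y ^ bottomVisits₀ p.1 p.2 n * z ^ topVisits₀ T p.1 p.2 n := by
        refine mul_le_mul_of_nonneg_left ?_ (pow_nonneg (mul_nonneg (zero_le_one.trans (one_le_yK y))
          (zero_le_one.trans (one_le_yK z))) _)
        exact Finset.sum_le_sum_of_subset_of_nonneg himg fun p _ _ =>
          mul_nonneg (pow_nonneg hy.le _) (pow_nonneg hz.le _)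

open Classical in
/-- Summing the fibrewise step over the `2(T+1)` starts of the cross-section. [cite: BeatonBousquetMelouDeGierDuminilCopinGuttmann2014, Proposition 6 (arXiv v5 p. 10); MadrasSlade1993, §8.2, eq. (8.2.1)] -/
theorem unfZ₂_le_of_injOn (T m n K : ℕ) (hy : 0 < y) (hz : 0 < z)
    (Φ : Site 2 × (ℕ → Site 2) → Site 2 × (ℕ → Site 2)) (P : Finset (Site 2 × (ℕ → Site 2)))
    (hΦ : ∀ q ∈ unfPairs T m, Φ q ∈ P ∧
      bottomVisits₀ q.1 q.2 m ≤ bottomVisits₀ (Φ q).1 (Φ q).2 n ∧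
      bottomVisits₀ (Φ q).1 (Φ q).2 n ≤ bottomVisits₀ q.1 q.2 m + K ∧
      topVisits₀ T q.1 q.2 m ≤ topVisits₀ T (Φ q).1 (Φ q).2 n ∧
      topVisits₀ T (Φ q).1 (Φ q).2 n ≤ topVisits₀ T q.1 q.2 m + K)
    (hinj : ∀ a : Site 2, Set.InjOn Φ {q | q ∈ unfPairs T m ∧ q.1 = a}) :
    unfZ₂ T m y z ≤ (2 * (T + 1)) * (yK y * yK z) ^ K * ∑ p ∈ P, y ^ bottomVisits₀ p.1 p.2 n * z ^ topVisits₀ T p.1 p.2 n := by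
  have hmaps : ∀ q ∈ unfPairs T m, q.1 ∈ stripStarts T := fun q hq =>
    (mem_stripPairs.1 (mem_unfPairs.1 hq).1).1
  rw [unfZ₂, ← Finset.sum_fiberwise_of_maps_to hmaps]
  set S := ∑ p ∈ P, y ^ bottomVisits₀ p.1 p.2 n * z ^ topVisits₀ T p.1 p.2 n with hS
  calc ∑ a ∈ stripStarts T, ∑ q ∈ (unfPairs T m).filter (fun q => q.1 = a),
        y ^ bottomVisits₀ q.1 q.2 m * z ^ topVisits₀ T q.1 q.2 m
      ≤ ∑ a ∈ stripStarts T, (yK y * yK z) ^ K * S :=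
        Finset.sum_le_sum fun a _ => sum_fibre_le_of_injOn T m n K hy hz a Φ P hΦ (hinj a)
    _ = (2 * (T + 1)) * (yK y * yK z) ^ K * S := by
        rw [Finset.sum_const, card_stripStarts, nsmul_eq_mul]; push_cast; ring

/-- **`U_{T,m}(y,z) ≤ 2(T+1) (max(1,y⁻¹) max(1,z⁻¹))^{4T+6} · A_{T,m+4T+6}(y,z)`** (`m` even, `y, z > 0`).
[cite: BeatonBousquetMelouDeGierDuminilCopinGuttmann2014, Proposition 6 (arXiv v5 p. 10; proof p. 11: "concatenation and unfolding arguments as given in Section 4 of [16]")] -/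
theorem unfZ₂_le_archZ₂ (T : ℕ) {m : ℕ} (hm : m % 2 = 0) (hy : 0 < y) (hz : 0 < z) :
    unfZ₂ T m y z ≤ (2 * (T + 1)) * (yK y * yK z) ^ (4 * T + 6) * archZ₂ T (m + (4 * T + 6)) y z :=
  unfZ₂_le_of_injOn T m (m + (4 * T + 6)) (4 * T + 6) hy hz (toArch T m) (archPairs T (m + (4 * T + 6)))
    (fun _ hq => toArch_spec hq hm) (toArch_injOn hm)

/-- **`U_{T,m}(y,z) ≤ 2(T+1) (max(1,y⁻¹) max(1,z⁻¹))^{4T+7} · B_{T,m+4T+7}(y,z)`** (`m` even, `y, z > 0`).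
[cite: BeatonBousquetMelouDeGierDuminilCopinGuttmann2014, Proposition 6 (arXiv v5 p. 10; proof p. 11: "concatenation and unfolding arguments as given in Section 4 of [16]")] -/
theorem unfZ₂_le_bridgeZ₂ (T : ℕ) {m : ℕ} (hm : m % 2 = 0) (hy : 0 < y) (hz : 0 < z) :
    unfZ₂ T m y z ≤ (2 * (T + 1)) * (yK y * yK z) ^ (4 * T + 7) * bridgeZ₂ T (m + (4 * T + 7)) y z :=
  unfZ₂_le_of_injOn T m (m + (4 * T + 7)) (4 * T + 7) hy hz (toBridge T m) (bridgePairs T (m + (4 * T + 7)))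
    (fun _ hq => toBridge_spec hq hm) (toBridge_injOn hm)

/-! ### Proposition 6, first clause: the arch and bridge growth rates -/

/-- `μ_T(y,z)^m ≤ max(1,y⁻¹) max(1,z⁻¹) · C_{T,m}(y,z)` for `m ≥ 1` (the infimum definition of `μ_T(y,z)`).
[cite: BeatonBousquetMelouDeGierDuminilCopinGuttmann2014, Proposition 6 (arXiv v5 p. 10); MadrasSlade1993, Lemma 1.2.2 (p. 9)] -/
theorem stripMuY₂_pow_le (T : ℕ) (hy : 0 < y) (hz : 0 < z) {m : ℕ} (hm : m ≠ 0) :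
    stripMuY₂ T y z ^ m ≤ yK y * yK z * stripZ₂ T m y z := by
  have h := stripMuY₂_le_rpow T hy hz hm
  have hK : 0 ≤ yK y * yK z * stripZ₂ T m y z :=
    mul_nonneg (mul_nonneg (zero_le_one.trans (one_le_yK y)) (zero_le_one.trans (one_le_yK z)))
      (stripZ₂_pos T m hy hz).le
  have h2 := pow_le_pow_left₀ (stripMuY₂_pos T hy hz).le h m
  rw [← Real.rpow_natCast ((yK y * yK z * stripZ₂ T m y z) ^ (1 / (m : ℝ))), ← Real.rpow_mul hK,
    one_div_mul_cancel (Nat.cast_ne_zero.2 hm), Real.rpow_one] at h2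
  exact h2

/-- The analytic squeeze behind Proposition 6: if `0 ≤ A_n ≤ C_{T,n}(y,z)` and
`μ_T(y,z)^{2j} ≤ C e^{6√(2j)} A_{2j+K}` for `j ≥ 1`, then `A_{2j+K}^{1/(2j+K)} → μ_T(y,z)`.
[cite: BeatonBousquetMelouDeGierDuminilCopinGuttmann2014, Proposition 6 (arXiv v5 p. 10); MadrasSlade1993, §3.1, Corollary 3.1.8 (the e^{O(√n)} factor does not change the growth rate)] -/
theorem tendsto_rpow_of_squeeze (T : ℕ) (hy : 0 < y) (hz : 0 < z) (K : ℕ) {C : ℝ} (hC : 0 < C) (A : ℕ → ℝ)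
    (hA0 : ∀ n, 0 ≤ A n) (hup : ∀ n, A n ≤ stripZ₂ T n y z)
    (hlow : ∀ j : ℕ, 1 ≤ j →
      stripMuY₂ T y z ^ (2 * j) ≤ C * Real.exp (6 * Real.sqrt ((2 * j : ℕ) : ℝ)) * A (2 * j + K)) :
    Tendsto (fun j : ℕ => A (2 * j + K) ^ (1 / ((2 * j + K : ℕ) : ℝ))) atTop (𝓝 (stripMuY₂ T y z)) := by
  set μ := stripMuY₂ T y z with hμ
  have hμ0 : 0 < μ := stripMuY₂_pos T hy hz
  -- the index `2j + K → ∞`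
  have hn : Tendsto (fun j : ℕ => 2 * j + K) atTop atTop :=
    Filter.tendsto_atTop_atTop.2 fun b => ⟨b, fun j hj => by omega⟩
  have hnR : Tendsto (fun j : ℕ => ((2 * j + K : ℕ) : ℝ)) atTop atTop := tendsto_natCast_atTop_atTop.comp hn
  -- upper function
  have hup' : Tendsto (fun j : ℕ => stripZ₂ T (2 * j + K) y z ^ (1 / ((2 * j + K : ℕ) : ℝ))) atTop (𝓝 μ) :=
    (tendsto_stripZ₂_rpow T hy hz).comp hn
  -- lower function
  set ℓ : ℕ → ℝ := fun j =>
    (C⁻¹ * Real.exp (-(6 * Real.sqrt ((2 * j : ℕ) : ℝ))) * μ ^ (2 * j)) ^ (1 / ((2 * j + K : ℕ) : ℝ)) with hℓ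
  have hbase : ∀ j : ℕ, 0 < C⁻¹ * Real.exp (-(6 * Real.sqrt ((2 * j : ℕ) : ℝ))) * μ ^ (2 * j) := fun j => by
    positivity
  -- the three elementary limits
  have h1 : Tendsto (fun j : ℕ => (1 : ℝ) / ((2 * j + K : ℕ) : ℝ)) atTop (𝓝 0) :=
    (tendsto_const_div_atTop_nhds_zero_nat (1 : ℝ)).comp hn
  have h2 : Tendsto (fun j : ℕ => (((2 * j : ℕ) : ℝ)) / ((2 * j + K : ℕ) : ℝ)) atTop (𝓝 1) := by
    have h2j : Tendsto (fun j : ℕ => 2 * j) atTop atTop :=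
      Filter.tendsto_atTop_atTop.2 fun b => ⟨b, fun j hj => by omega⟩
    have h := (tendsto_natCast_div_add_atTop (K : ℝ)).comp h2j
    refine h.congr fun j => ?_
    simp only [Function.comp_apply]
    push_cast
    ring_nf
  have h3 : Tendsto (fun j : ℕ => Real.sqrt ((2 * j : ℕ) : ℝ) / ((2 * j + K : ℕ) : ℝ)) atTop (𝓝 0) := by
    have hinv : Tendsto (fun j : ℕ => (Real.sqrt ((2 * j + K : ℕ) : ℝ))⁻¹) atTop (𝓝 0) :=
      tendsto_inv_atTop_zero.comp (Real.tendsto_sqrt_atTop.comp hnR)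
    refine squeeze_zero (fun j => by positivity) (fun j => ?_) hinv
    have hle : ((2 * j : ℕ) : ℝ) ≤ ((2 * j + K : ℕ) : ℝ) := by exact_mod_cast Nat.le_add_right _ _
    have ht0 : 0 ≤ ((2 * j + K : ℕ) : ℝ) := by positivity
    calc Real.sqrt ((2 * j : ℕ) : ℝ) / ((2 * j + K : ℕ) : ℝ)
        ≤ Real.sqrt ((2 * j + K : ℕ) : ℝ) / ((2 * j + K : ℕ) : ℝ) :=
          div_le_div_of_nonneg_right (Real.sqrt_le_sqrt hle) ht0
      _ = (Real.sqrt ((2 * j + K : ℕ) : ℝ))⁻¹ := Real.sqrt_div_self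
  -- the exponent of the lower function tends to `log μ`
  have hE : Tendsto (fun j : ℕ =>
      (Real.log C⁻¹ - 6 * Real.sqrt ((2 * j : ℕ) : ℝ) + ((2 * j : ℕ) : ℝ) * Real.log μ) *
        (1 / ((2 * j + K : ℕ) : ℝ))) atTop (𝓝 (Real.log μ)) := by
    have h := ((h1.const_mul (Real.log C⁻¹)).sub (h3.const_mul 6)).add (h2.mul_const (Real.log μ))
    rw [mul_zero, mul_zero, sub_zero, zero_add, one_mul] at h
    refine h.congr fun j => ?_
    ring
  have hℓlim : Tendsto ℓ atTop (𝓝 μ) := by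
    have h := (Real.continuous_exp.tendsto _).comp hE
    rw [Real.exp_log hμ0] at h
    refine h.congr fun j => ?_
    rw [Function.comp_apply, hℓ]
    dsimp only
    rw [Real.rpow_def_of_pos (hbase j), Real.log_mul (by positivity) (by positivity),
      Real.log_mul (by positivity) (by positivity), Real.log_exp, Real.log_pow]
    congr 1
  -- the squeeze
  refine tendsto_of_tendsto_of_tendsto_of_le_of_le' hℓlim hup' ?_ (Eventually.of_forall fun j => ?_)
  · filter_upwards [eventually_ge_atTop 1] with j hj
    have hpos : 0 < C * Real.exp (6 * Real.sqrt ((2 * j : ℕ) : ℝ)) := by positivity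
    have hle : C⁻¹ * Real.exp (-(6 * Real.sqrt ((2 * j : ℕ) : ℝ))) * μ ^ (2 * j) ≤ A (2 * j + K) := by
      have h := hlow j hj
      rw [Real.exp_neg]
      calc C⁻¹ * (Real.exp (6 * Real.sqrt ((2 * j : ℕ) : ℝ)))⁻¹ * μ ^ (2 * j)
          ≤ C⁻¹ * (Real.exp (6 * Real.sqrt ((2 * j : ℕ) : ℝ)))⁻¹ *
              (C * Real.exp (6 * Real.sqrt ((2 * j : ℕ) : ℝ)) * A (2 * j + K)) :=
            mul_le_mul_of_nonneg_left h (by positivity)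
        _ = A (2 * j + K) := by field_simp
    exact Real.rpow_le_rpow (hbase j).le hle (by positivity)
  · exact Real.rpow_le_rpow (hA0 _) (hup _) (by positivity)

/-- The lower bound chain for arches: `μ_T(y,z)^{2j} ≤ K₀ e^{6√(2j)} · 2(T+1) K₀^{4T+6} · A_{T,2j+4T+6}(y,z)`,
`K₀ = max(1,y⁻¹) max(1,z⁻¹)`. [cite: BeatonBousquetMelouDeGierDuminilCopinGuttmann2014, Proposition 6 (arXiv v5 p. 10)] -/
theorem stripMuY₂_pow_le_archZ₂ (T : ℕ) (hy : 0 < y) (hz : 0 < z) {j : ℕ} (hj : 1 ≤ j) :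
    stripMuY₂ T y z ^ (2 * j) ≤
      (yK y * yK z * ((2 * (T + 1)) * (yK y * yK z) ^ (4 * T + 6))) * Real.exp (6 * Real.sqrt ((2 * j : ℕ) : ℝ)) *
        archZ₂ T (2 * j + (4 * T + 6)) y z := by
  have hK0 : 0 ≤ yK y * yK z := mul_nonneg (zero_le_one.trans (one_le_yK y)) (zero_le_one.trans (one_le_yK z))
  have h1 := stripMuY₂_pow_le T hy hz (m := 2 * j) (by omega)
  have h2 := stripZ₂_le_exp_mul_unfZ₂ T (n := 2 * j) (by omega) hy.le hz.le
  have h3 := unfZ₂_le_archZ₂ T (m := 2 * j) (by omega) hy hz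
  have hexp : 0 ≤ Real.exp (6 * Real.sqrt ((2 * j : ℕ) : ℝ)) := Real.exp_nonneg _
  calc stripMuY₂ T y z ^ (2 * j) ≤ yK y * yK z * stripZ₂ T (2 * j) y z := h1
    _ ≤ yK y * yK z * (Real.exp (6 * Real.sqrt ((2 * j : ℕ) : ℝ)) * unfZ₂ T (2 * j) y z) :=
        mul_le_mul_of_nonneg_left h2 hK0
    _ ≤ yK y * yK z * (Real.exp (6 * Real.sqrt ((2 * j : ℕ) : ℝ)) *
          ((2 * (T + 1)) * (yK y * yK z) ^ (4 * T + 6) * archZ₂ T (2 * j + (4 * T + 6)) y z)) :=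
        mul_le_mul_of_nonneg_left (mul_le_mul_of_nonneg_left h3 hexp) hK0
    _ = _ := by ring

/-- The lower bound chain for bridges. [cite: BeatonBousquetMelouDeGierDuminilCopinGuttmann2014, Proposition 6 (arXiv v5 p. 10)] -/
theorem stripMuY₂_pow_le_bridgeZ₂ (T : ℕ) (hy : 0 < y) (hz : 0 < z) {j : ℕ} (hj : 1 ≤ j) :
    stripMuY₂ T y z ^ (2 * j) ≤
      (yK y * yK z * ((2 * (T + 1)) * (yK y * yK z) ^ (4 * T + 7))) * Real.exp (6 * Real.sqrt ((2 * j : ℕ) : ℝ)) *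
        bridgeZ₂ T (2 * j + (4 * T + 7)) y z := by
  have hK0 : 0 ≤ yK y * yK z := mul_nonneg (zero_le_one.trans (one_le_yK y)) (zero_le_one.trans (one_le_yK z))
  have h1 := stripMuY₂_pow_le T hy hz (m := 2 * j) (by omega)
  have h2 := stripZ₂_le_exp_mul_unfZ₂ T (n := 2 * j) (by omega) hy.le hz.le
  have h3 := unfZ₂_le_bridgeZ₂ T (m := 2 * j) (by omega) hy hz
  have hexp : 0 ≤ Real.exp (6 * Real.sqrt ((2 * j : ℕ) : ℝ)) := Real.exp_nonneg _
  calc stripMuY₂ T y z ^ (2 * j) ≤ yK y * yK z * stripZ₂ T (2 * j) y z := h1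
    _ ≤ yK y * yK z * (Real.exp (6 * Real.sqrt ((2 * j : ℕ) : ℝ)) * unfZ₂ T (2 * j) y z) :=
        mul_le_mul_of_nonneg_left h2 hK0
    _ ≤ yK y * yK z * (Real.exp (6 * Real.sqrt ((2 * j : ℕ) : ℝ)) *
          ((2 * (T + 1)) * (yK y * yK z) ^ (4 * T + 7) * bridgeZ₂ T (2 * j + (4 * T + 7)) y z)) :=
        mul_le_mul_of_nonneg_left (mul_le_mul_of_nonneg_left h3 hexp) hK0
    _ = _ := by ring

/-- **BBdGDCG14 Proposition 6, arches: `A_{T,n}(y,z)^{1/n} → μ_T(y,z)` along the even lengths** (arches of the brick-wall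
strip have even length: both endpoints are bottom-surface vertices).
[cite: BeatonBousquetMelouDeGierDuminilCopinGuttmann2014, Proposition 6 (arXiv v5 p. 10: "lim A_{T,n}(y,z)^{1/n} = … = lim C_{T,n}(y,z)^{1/n} =: μ_T(y,z)")] -/
theorem tendsto_archZ₂_rpow (T : ℕ) (hy : 0 < y) (hz : 0 < z) :
    Tendsto (fun j : ℕ => archZ₂ T (2 * j) y z ^ (1 / ((2 * j : ℕ) : ℝ))) atTop (𝓝 (stripMuY₂ T y z)) := by
  have hC : 0 < yK y * yK z * ((2 * (T + 1)) * (yK y * yK z) ^ (4 * T + 6)) := by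
    have h1 : 0 < yK y := zero_lt_one.trans_le (one_le_yK y)
    have h2 : 0 < yK z := zero_lt_one.trans_le (one_le_yK z)
    positivity
  have h := tendsto_rpow_of_squeeze T hy hz (4 * T + 6) hC (fun n => archZ₂ T n y z)
    (fun n => archZ₂_nonneg T n hy.le hz.le) (fun n => archZ₂_le_stripZ₂ T n hy.le hz.le)
    (fun j hj => stripMuY₂_pow_le_archZ₂ T hy hz hj)
  rw [← Filter.tendsto_add_atTop_iff_nat (2 * T + 3)]
  refine h.congr fun j => ?_
  rw [show 2 * (j + (2 * T + 3)) = 2 * j + (4 * T + 6) by ring]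

/-- **BBdGDCG14 Proposition 6, bridges: `B_{T,n}(y,z)^{1/n} → μ_T(y,z)` along the odd lengths** (bridges of the
brick-wall strip from a bottom-surface vertex to a top-surface vertex have odd length).
[cite: BeatonBousquetMelouDeGierDuminilCopinGuttmann2014, Proposition 6 (arXiv v5 p. 10: "lim B_{T,n}(y,z)^{1/n} = lim C_{T,n}(y,z)^{1/n} =: μ_T(y,z)")] -/
theorem tendsto_bridgeZ₂_rpow (T : ℕ) (hy : 0 < y) (hz : 0 < z) :
    Tendsto (fun j : ℕ => bridgeZ₂ T (2 * j + 1) y z ^ (1 / ((2 * j + 1 : ℕ) : ℝ))) atTop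
      (𝓝 (stripMuY₂ T y z)) := by
  have hC : 0 < yK y * yK z * ((2 * (T + 1)) * (yK y * yK z) ^ (4 * T + 7)) := by
    have h1 : 0 < yK y := zero_lt_one.trans_le (one_le_yK y)
    have h2 : 0 < yK z := zero_lt_one.trans_le (one_le_yK z)
    positivity
  have h := tendsto_rpow_of_squeeze T hy hz (4 * T + 7) hC (fun n => bridgeZ₂ T n y z)
    (fun n => bridgeZ₂_nonneg T n hy.le hz.le) (fun n => bridgeZ₂_le_stripZ₂ T n hy.le hz.le)
    (fun j hj => stripMuY₂_pow_le_bridgeZ₂ T hy hz hj)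
  rw [← Filter.tendsto_add_atTop_iff_nat (2 * T + 3)]
  refine h.congr fun j => ?_
  rw [show 2 * (j + (2 * T + 3)) + 1 = 2 * j + (4 * T + 7) by ring]

/-- **Proposition 6 for the printed one-surface weight `μ_T(y,1)`**: arches, `A_{T,n}(y,1)^{1/n} → μ_T(y,1) = HexBW.stripMuY₀ T y`
along even `n`. [cite: BeatonBousquetMelouDeGierDuminilCopinGuttmann2014, Proposition 6 (arXiv v5 p. 10)] -/
theorem tendsto_archZ₂_rpow_one (T : ℕ) (hy : 0 < y) :
    Tendsto (fun j : ℕ => archZ₂ T (2 * j) y 1 ^ (1 / ((2 * j : ℕ) : ℝ))) atTop (𝓝 (stripMuY₀ T y)) := by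
  rw [← stripMuY₂_one_right]
  exact tendsto_archZ₂_rpow T hy one_pos

/-- **Proposition 6 for the printed one-surface weight `μ_T(y,1)`**: bridges, `B_{T,n}(y,1)^{1/n} → μ_T(y,1)` along odd `n`.
[cite: BeatonBousquetMelouDeGierDuminilCopinGuttmann2014, Proposition 6 (arXiv v5 p. 10)] -/
theorem tendsto_bridgeZ₂_rpow_one (T : ℕ) (hy : 0 < y) :
    Tendsto (fun j : ℕ => bridgeZ₂ T (2 * j + 1) y 1 ^ (1 / ((2 * j + 1 : ℕ) : ℝ))) atTop (𝓝 (stripMuY₀ T y)) := by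
  rw [← stripMuY₂_one_right]
  exact tendsto_bridgeZ₂_rpow T hy one_pos

end Literature.Probability.RandomPlanarGeometry.SAW.HexBW
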